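import Summits.KontsevichZagierPeriods.KontsevichZagierPeriods.Theses.FermatIsogeny
import Summits.KontsevichZagierPeriods.KontsevichZagierPeriods.Theorems.SymplecticScissorsRealOnePeriodRelationsIsoLayer
import Summits.KontsevichZagierPeriods.KontsevichZagierPeriods.Theorems.SymplecticScissorsRealOnePeriodRelationsConditional
import Summits.KontsevichZagierPeriods.KontsevichZagierPeriods.Theorems.RealOnePeriodRelations.Negative.Kit
import Literature.NumberTheory.Transcendental.CurvePeriods
import Literature.NumberTheory.Transcendental.KZCalculus
import Literature.NumberTheory.Transcendental.KZGroundingRelations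
import Literature.NumberTheory.Transcendental.KZLogCalculus
import Literature.ModelTheory.ExponentialFields.CylindricalDecomposition
import Summits.KontsevichZagierPeriods.KontsevichZagierPeriods.Theorems.FermatIsogenyBetaLinearSectorStubBandNewtonLeibnizCad
import Summits.KontsevichZagierPeriods.KontsevichZagierPeriods.Theorems.FermatIsogenyBetaLinearSectorStubFermatIntegrand
import Summits.KontsevichZagierPeriods.KontsevichZagierPeriods.Theorems.FermatIsogenyBetaLinearSectorStubFermatSymbolData
import Summits.KontsevichZagierPeriods.KontsevichZagierPeriods.Theorems.FermatIsogenyBetaLinearSectorStubGreenOfEngine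
import Summits.KontsevichZagierPeriods.KontsevichZagierPeriods.Theorems.FermatIsogenyBetaLinearSectorStubBandNewtonLeibnizEngine
import Summits.KontsevichZagierPeriods.KontsevichZagierPeriods.Theorems.IsogenyCertificatesGenusTwoRealPeriodCellStubSubband
import Summits.KontsevichZagierPeriods.KontsevichZagierPeriods.Theorems.FermatIsogenyBetaLinearSectorStubFermatRealise
import Summits.KontsevichZagierPeriods.KontsevichZagierPeriods.Theorems.FermatIsogenyBetaLinearSectorStubTwoTermRelation
import Summits.KontsevichZagierPeriods.KontsevichZagierPeriods.Theorems.FermatIsogenyBetaLinearSectorStubRungOfArcRelation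
import Summits.KontsevichZagierPeriods.KontsevichZagierPeriods.Theorems.FermatIsogenyBetaLinearSectorStubPinnedReflect
import Summits.KontsevichZagierPeriods.KontsevichZagierPeriods.Theorems.FermatIsogenyBetaLinearSectorStubFermatS3Class
import Mathlib.RingTheory.Algebraic.Basic
import Summits.KontsevichZagierPeriods.KontsevichZagierPeriods.Theorems.FermatIsogenyBetaLinearSectorGreen
import Literature.NumberTheory.Transcendental.CurvePeriodsGmLoopsProofs
import Literature.NumberTheory.Transcendental.CurvePeriodsTransportProofs
import Literature.NumberTheory.Transcendental.CurvePeriodsPathCalculusProofs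
import Literature.NumberTheory.Transcendental.CurvePeriodsPathHomotopicProofs
import Mathlib.Analysis.SpecialFunctions.Pow.Continuity
import Mathlib.Analysis.SpecialFunctions.Complex.Log
import Mathlib.Analysis.Convex.Contractible

/-!
# `BetaLinearSector` (stmt-KontsevichZagierPeriods-3897, route FermatIsogeny, crux rank 3) — line `fermat-sector-transport`
# (lead skeleton, reshape 1, prover-line-stmt-KontsevichZagierPeriods-3897-c1-0, 2026-08-17;
#  reshape 2 = section `Sector` (the Fermat reflection class at all levels), lead c4, prover-line-stmt-KontsevichZagierPeriods-3897-c4-0)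

Crux (fixed, concluded BY NAME below by `BetaLinearSector_of`): for positive rationals `a b a' b'` and a real algebraic
`c`, two one-dimensional representations pinned on `(0,1)` as `[t^{a-1}(1-t)^{b-1}]` and `[c·t^{a'-1}(1-t)^{b'-1}]` with
the same value are KZ-equivalent (Conjecture 1 on the beta-LINEAR sector, all levels at once).

LINE `fermat-sector-transport` (strategist's second alternative to `Lines/birth.lean`, adopted by the lead; lens = TRANSFER
from the solved sibling step `SymplecticScissors.RealOnePeriodRelations`, stmt-10042).  The landed sector-parametric
composition `SectorGlue.realOnePeriodRelations_of_sector` (Theorems/SymplecticScissorsRealOnePeriodRelationsIsoLayer.lean,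
p131951) is fed with

* `G`  := the formal classes of BETA CELLS (`[c·t^{a-1}(1-t)^{b-1}]` on `(0,1)`, `a, b ∈ ℚ_{>0}`, `c` real algebraic);
* `Ps` := symbols on affine FERMAT CURVES `F_N = {x^N + y^N = 1} ⊂ ℂ²`, `N ≥ 1` (any algebraic polynomial form, any `C¹` path
  with algebraic end points);

RESHAPE 1 (this file).  Registered stubs:

* APEX `stub_huberWustholzCurvePeriods : HuberWustholzCurvePeriods` — the EXISTING Literature named fact Huber–Wüstholz 2022
  Thm 13.3 (2) (all curve-type symbols); it implies the sector hypothesis on Fermat symbols (one line, `huberWustholzBetaArcs_of`).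
  Held by the lead; terminal status of the line = `blocked-on:` this fact.  The typed FERMAT LAYER `fermatLayer` keeps the
  sector-restricted hypothesis, for a future CM analytic-subgroup engine.
* FERMAT NORMALISATION (three stubs, glued sorry-free into `betaArcs` below, pattern `EllipticLayer.ellArcs`):
  `stub_fermatSymbolData` (`F_N` is a smooth affine curve over `ℚ̄`; the RADIAL ARC `γ_N(t) = Q(t)^{-1/N}·(1−t, t)`,
  `Q(t) = (1−t)^N + t^N`, of `F_N(ℝ)` from `(1,0)` to `(0,1)` is a `C¹` path with algebraic end points, semialgebraic as a real
  map), `stub_fermatIntegrand` (along `γ_N`, Rohrlich's polynomial form `ω_{r,s} = x^{r-1}y^{s-1}(y dx − x dy)` pulls back to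
  `−(1−t)^{r−1} t^{s−1} Q(t)^{−(r+s)/N} dt`, because `y x′ − x y′ = −Q^{-2/N}`), `stub_fermatRealise` (ONE rational rule-2 move
  `τ = (1−u)^N/Q(u)` carries the beta cell `[c·τ^{r/N−1}(1−τ)^{s/N−1}]` to the bounded arc representation
  `[c·N·(1−u)^{r−1}u^{s−1}Q^{−(r+s)/N}]` modulo `M₁`, via the landed `helper_cells_1`).
* GREEN (four stubs, implication-shaped and independent; together `greenSet ⊆ KZ.relations`, the glue stub of crux
  `PlanarAreas` stmt-4990, 5/7 of whose stubs are landed theorems): `stub_bandNewtonLeibniz_cad` and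
  `stub_bandNewtonLeibniz_subband` (signatures VERBATIM from stmt-4990's registry, certified by drefute gen 3),
  `stub_bandNewtonLeibniz_of_cad_of_subband` (the engine: Newton–Leibniz down a band off a null set, assembled from the two),
  `stub_greenInRelations_of_bandNewtonLeibniz` (Green's formula on the native triangle = engine ×2 + swap + reflection + 1b,
  over the landed `PlanarAreas.stub_{fibreDerivSemialgebraic,mixedPartials,derivIntegrable,swap}`).

COMPOSITION (sorry-free): `betaCells` (closure induction) + `betaArcs` (from the three Fermat stubs) +
`SectorGlue.realOnePeriodRelations_of_sector` give `fermatLayer`; `M₁_le_relations` from Green; `betaLinearSector_of_layer`;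
`BetaLinearSector_of : BetaLinearSector` by name.  Also recorded: `BetaLinearSector_of_subs` (the whole crux from the apex and
Green alone, through the landed `realOnePeriodRelations_of_huberWustholzCurvePeriods` — line `hw-real-transport` is contained
in this one).

Disproof used: none on file (no `Cruxes/BetaLinearSector/Disproof.lean`; `ledger negatives`: nothing on beta pairs).
Dead lines: none on file.  All registered statements are over existing declarations only (the Fermat data are inlined).
-/

noncomputable section

set_option linter.dupNamespace false

namespace Summit.KontsevichZagierPeriods.KontsevichZagierPeriods.Cruxes.BetaLinearSector.FermatSectorTransport

open scoped BigOperators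
open MeasureTheory Set MvPolynomial
open Literature.NumberTheory.Transcendental Literature.NumberTheory.Transcendental.CurvePeriods
open Literature.ModelTheory.ExponentialFields (IsSemialgebraic)
open Summit.KontsevichZagierPeriods.SymplecticScissors.RealOnePeriodRelationsNegative (greenSet M₁ H₁ crux_iff)
open Summit.KontsevichZagierPeriods.SymplecticScissors.RealOnePeriodRelations (Cells.combo_add Cells.combo_neg
  Cells.combo_single stub_realises)
open Summit.KontsevichZagierPeriods.KontsevichZagierPeriods.Theses.FermatIsogeny (BetaLinearSector)

/-! ## Vocabulary of the layer (abbreviations internal to the skeleton; every REGISTERED statement inlines them) -/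

/-- BETA CELLS: one-dimensional representations pinned on `(0,1)` as `c·t^{a-1}(1-t)^{b-1}` with `a, b`
positive rationals and `c` real algebraic (the hypothesis shape of the crux, both sides). [cite: KontsevichZagier2001, §1.1] -/
def betaCellSet : Set (KZ.IntegralRep 1) :=
  {ρ | ∃ (a b : ℚ) (c : ℝ), 0 < a ∧ 0 < b ∧ IsAlgebraic ℚ c ∧ ρ.domain = {x | x 0 ∈ Set.Ioo (0:ℝ) 1} ∧
    Set.EqOn ρ.integrand (fun x => c * (x 0) ^ ((a:ℝ) - 1) * (1 - x 0) ^ ((b:ℝ) - 1)) ρ.domain}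

/-- The affine FERMAT CURVE `F_N = {x^N + y^N = 1} ⊂ ℂ²` as curve data. [cite: Gross1978, §1] -/
abbrev fermatCurve (N : ℕ) : CurveData := ⟨2, 1, ![X 0 ^ N + X 1 ^ N - 1]⟩

/-- Rohrlich's form made POLYNOMIAL: `ω_{r,s} = x^{r-1} y^{s-1} (y dx − x dy)`. [cite: Gross1978, §1 (Rohrlich's appendix)] -/
abbrev betaForm (r s : ℕ) : Fin 2 → MvPolynomial (Fin 2) ℂ :=
  ![X 0 ^ (r - 1) * X 1 ^ s, -(X 0 ^ r * X 1 ^ (s - 1))]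

/-- FERMAT BETA-ARC SYMBOLS (a predicate, internal abbreviation; every registered/landed statement inlines it): the symbols
`(F_N, ω_{r,s}, γ_N)` with `N, r, s ≥ 1` and `γ_N` the radial arc between the cusps `(1,0)`, `(0,1)` — the Wolfart–Wüstholz
setting. [folklore] -/
def IsBetaArcSymbol (σ : PeriodSymbol) : Prop :=
  ∃ (N r s : ℕ) (hZ : (fermatCurve N).IsSmoothAffineCurve) (γ : CurvePath (fermatCurve N))
    (hω : ∀ i, HasAlgCoeffs (betaForm r s i)),
    1 ≤ N ∧ 1 ≤ r ∧ 1 ≤ s ∧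
    (∀ t : ℝ, γ.toFun t = ![(((1 - t) * ((1 - t) ^ N + t ^ N) ^ (-(1:ℝ) / N) : ℝ) : ℂ),
      ((t * ((1 - t) ^ N + t ^ N) ^ (-(1:ℝ) / N) : ℝ) : ℂ)]) ∧
    σ = ⟨fermatCurve N, hZ, betaForm r s, hω, γ⟩

/-- The generator set of the layer: formal classes of beta cells. -/
def betaGens : Set KZ.FormalRep := (fun ρ : KZ.IntegralRep 1 => KZ.of ρ) '' betaCellSet

/-! ## The registered stubs -/

/-- APEX (named fact, held by the lead): Huber–Wüstholz 2022, Thm 13.3 (2) — Kontsevich's period conjecture for periods of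
curve type, as the tree's named fact `HuberWustholzCurvePeriods`. Shared apex with `RealOnePeriodRelations` (stmt-10042).
[cite: HuberWustholz2022, Thm 13.3 (2)] -/
theorem stub_huberWustholzCurvePeriods :
    Literature.NumberTheory.Transcendental.HuberWustholzCurvePeriods := by
  sorry

/-- FERMAT STUB 1 (symbol data): for `N ≥ 1` the affine Fermat curve `x^N + y^N = 1` is a smooth affine curve over `ℚ̄`
(gradient `(N x^{N-1}, N y^{N-1}) ≠ 0` on the curve; no isolated points by a local `N`-th root), and the radial arc
`γ_N(t) = ((1−t)·Q(t)^{−1/N}, t·Q(t)^{−1/N})`, `Q(t) = (1−t)^N + t^N > 0`, is a `C¹` path on it with the algebraic end points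
`(1,0)`, `(0,1)`, whose real and imaginary parts form a `ℚ`-semialgebraic map on `[0,1]`. [cite: Gross1978, §1] [cite: HuberWustholz2022, §3.3.1] -/
theorem stub_fermatSymbolData : ∀ N : ℕ, 1 ≤ N →
    (⟨2, 1, ![X 0 ^ N + X 1 ^ N - 1]⟩ : CurveData).IsSmoothAffineCurve ∧
    ∃ γ : CurvePath (⟨2, 1, ![X 0 ^ N + X 1 ^ N - 1]⟩ : CurveData),
      (∀ t : ℝ, γ.toFun t = ![(((1 - t) * ((1 - t) ^ N + t ^ N) ^ (-(1:ℝ) / N) : ℝ) : ℂ),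
        ((t * ((1 - t) ^ N + t ^ N) ^ (-(1:ℝ) / N) : ℝ) : ℂ)]) ∧
      IsSemialgebraicMapOn ℚ {z : Fin 1 → ℝ | z 0 ∈ Set.Icc (0 : ℝ) 1}
        (fun z => Fin.append (fun i => (γ.toFun (z 0) i).re) (fun i => (γ.toFun (z 0) i).im)) :=
  -- LANDED (p147936): Theorems/FermatIsogenyBetaLinearSectorStubFermatSymbolData.lean
  Summit.KontsevichZagierPeriods.FermatIsogeny.BetaLinearSector.stub_fermatSymbolData

/-- FERMAT STUB 2 (the arc integrand): along the radial arc, Rohrlich's polynomial form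
`ω_{r,s} = x^{r-1}y^{s} dx − x^{r}y^{s-1} dy = x^{r-1}y^{s-1}(y dx − x dy)` evaluates to
`−(1−t)^{r−1} t^{s−1} Q(t)^{−(r+s)/N}` (`y x′ − x y′ = −Q^{−2/N}`: the derivative of `Q^{−1/N}` cancels). [cite: Gross1978, §1 (Rohrlich's appendix)] -/
theorem stub_fermatIntegrand : ∀ (N r s : ℕ), 1 ≤ N → 1 ≤ r → 1 ≤ s →
    ∀ γ : CurvePath (⟨2, 1, ![X 0 ^ N + X 1 ^ N - 1]⟩ : CurveData),
    (∀ t : ℝ, γ.toFun t = ![(((1 - t) * ((1 - t) ^ N + t ^ N) ^ (-(1:ℝ) / N) : ℝ) : ℂ),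
        ((t * ((1 - t) ^ N + t ^ N) ^ (-(1:ℝ) / N) : ℝ) : ℂ)]) →
    ∀ t ∈ Set.Ioo (0:ℝ) 1,
      (∑ i, MvPolynomial.eval (γ.toFun t)
          ((![X 0 ^ (r - 1) * X 1 ^ s, -(X 0 ^ r * X 1 ^ (s - 1))] : Fin 2 → MvPolynomial (Fin 2) ℂ) i) *
        deriv (fun u => γ.toFun u i) t) =
      ((-((1 - t) ^ (r - 1) * t ^ (s - 1) * ((1 - t) ^ N + t ^ N) ^ (-((r:ℝ) + s) / N)) : ℝ) : ℂ) :=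
  -- LANDED (p147793): Theorems/FermatIsogenyBetaLinearSectorStubFermatIntegrand.lean
  Summit.KontsevichZagierPeriods.FermatIsogeny.BetaLinearSector.stub_fermatIntegrand

/-- FERMAT STUB 3 (rule 2 along `τ = (1−u)^N / Q(u)`): the beta cell `[c·τ^{r/N−1}(1−τ)^{s/N−1}]` on `(0,1)` and the arc
representation `[c·N·(1−u)^{r−1}u^{s−1}Q(u)^{−(r+s)/N}]` on `(0,1)` differ by an element of `M₁` — the push-forward of the
latter along the strictly decreasing rational chart `φ(u) = (1−u)^N/Q(u)` (`φ′ = −N u^{N−1}(1−u)^{N−1}/Q²`, image `(0,1)`;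
`helper_cells_1`) has the integrand of the former (`τ = x^N`, `1 − τ = y^N`), then rule 1b. [cite: KontsevichZagier2001, §1.2 rule (2)] -/
theorem stub_fermatRealise : ∀ (N r s : ℕ) (c : ℝ), 1 ≤ N → 1 ≤ r → 1 ≤ s → IsAlgebraic ℚ c →
    ∀ (ρ R : KZ.IntegralRep 1), ρ.domain = {z | z 0 ∈ Set.Ioo (0:ℝ) 1} →
    Set.EqOn ρ.integrand (fun z => c * (z 0) ^ ((r:ℝ) / N - 1) * (1 - z 0) ^ ((s:ℝ) / N - 1)) ρ.domain →
    R.domain = {z | z 0 ∈ Set.Ioo (0:ℝ) 1} →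
    (∀ z ∈ R.domain, R.integrand z =
      c * N * ((1 - z 0) ^ (r - 1) * (z 0) ^ (s - 1) * ((1 - z 0) ^ N + (z 0) ^ N) ^ (-((r:ℝ) + s) / N))) →
    KZ.of ρ - KZ.of R ∈ M₁ :=
  -- LANDED (p148852): Theorems/FermatIsogenyBetaLinearSectorStubFermatRealise.lean
  Summit.KontsevichZagierPeriods.FermatIsogeny.BetaLinearSector.stub_fermatRealise

/-- GREEN STUB 1 (verbatim `stub_bandNewtonLeibniz_cad` of crux PlanarAreas, stmt-4990): a `ℚ`-cylindrical decomposition of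
`ℝⁿ` whose bands are adapted to two `ℚ`-semialgebraic sets `σ, τ ⊆ ℝⁿ⁺¹` — every band is inside `τ` or disjoint from it, and over
each cell a FIXED set `B` of bands inside `σ` catches every `σ`-point off the section graphs
(`IsSemialgebraic.exists_cylindricalDecomposition.exists_fibre_eq` run for the family `{σ, τ}`). [cite: BasuPollackRoy2006, Cor. 5.7] -/
theorem stub_bandNewtonLeibniz_cad : ∀ {n : ℕ} {σ τ : Set (Fin (n + 1) → ℝ)}, IsSemialgebraic ℚ σ → IsSemialgebraic ℚ τ →
    ∃ (𝒮 : Finset (Set (Fin n → ℝ))) (l : Set (Fin n → ℝ) → ℕ) (ξ : (S : Set (Fin n → ℝ)) → Fin (l S) → (Fin n → ℝ) → ℝ),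
      Literature.ModelTheory.ExponentialFields.IsCylindricalDecomposition ℚ n 𝒮 ∧
      (∀ S ∈ 𝒮, ∀ j, IsSemialgebraicFunOn ℚ S (ξ S j)) ∧ (∀ S ∈ 𝒮, ∀ x ∈ S, StrictMono fun j => ξ S j x) ∧
      (∀ S ∈ 𝒮, ∀ j, Literature.ModelTheory.ExponentialFields.bandOver S (ξ S) j ⊆ τ ∨
        Disjoint (Literature.ModelTheory.ExponentialFields.bandOver S (ξ S) j) τ) ∧
      ∀ S ∈ 𝒮, ∃ B : Finset (Fin (l S + 1)), (∀ j ∈ B, Literature.ModelTheory.ExponentialFields.bandOver S (ξ S) j ⊆ σ) ∧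
        ∀ x ∈ S, ∀ t : ℝ, (Fin.snoc x t : Fin (n + 1) → ℝ) ∈ σ → (∃ j, t = ξ S j x) ∨
          ∃ j ∈ B, Literature.ModelTheory.ExponentialFields.bandLower (ξ S) j x < t ∧
            (t : EReal) < Literature.ModelTheory.ExponentialFields.bandUpper (ξ S) j x :=
  -- LANDED (p147612): Theorems/FermatIsogenyBetaLinearSectorStubBandNewtonLeibnizCad.lean
  Summit.KontsevichZagierPeriods.FermatIsogeny.BetaLinearSector.stub_bandNewtonLeibniz_cad

/-- GREEN STUB 2 (verbatim `stub_bandNewtonLeibniz_subband` of crux PlanarAreas, stmt-4990): ONE Newton–Leibniz move on a closed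
sub-band `{x ∈ C, lo x ≤ t ≤ hi x}` of the engine's band that avoids the exceptional set `Z`, with the primitive `F` itself: the
sub-band representation and the base representation `[C, F(·,hi) − F(·,lo)]` exist and differ by an element of `newtonLeibnizRel`.
Guards `lo < hi`, band, `Z`, strip are load-bearing (Negative/GreenBandsSubbandLoadBearing). [cite: KontsevichZagier2001, §1.2 rule (3)] -/
theorem stub_bandNewtonLeibniz_subband : ∀ (a₀ a₁ : ℚ) (α β : ℝ → ℝ) (F : (Fin 2 → ℝ) → ℝ) (Z : Set (Fin 2 → ℝ))
    (r : KZ.IntegralRep 2), r.domain = {p : Fin 2 → ℝ | p 0 ∈ Set.Icc (a₀ : ℝ) a₁ ∧ α (p 0) ≤ p 1 ∧ p 1 ≤ β (p 0)} →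
    IsSemialgebraicFunOn ℚ r.domain F → (∃ M : ℝ, ∀ p ∈ r.domain, |F p| ≤ M) →
    (∀ t ∈ Set.Ioo (a₀ : ℝ) a₁, ContinuousOn (fun s : ℝ => F ![t, s]) (Set.Icc (α t) (β t))) →
    (∀ p ∈ r.domain, p 0 ∈ Set.Ioo (a₀ : ℝ) a₁ → α (p 0) < p 1 → p 1 < β (p 0) → p ∉ Z →
      HasDerivAt (fun s : ℝ => F ![p 0, s]) (r.integrand p) (p 1)) →
    ∀ {C : Set (Fin 1 → ℝ)}, IsSemialgebraic ℚ C → C ⊆ {x | x 0 ∈ Set.Ioo (a₀ : ℝ) a₁} →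
    ∀ {lo hi : (Fin 1 → ℝ) → ℝ}, IsSemialgebraicFunOn ℚ C lo → IsSemialgebraicFunOn ℚ C hi → (∀ x ∈ C, lo x < hi x) →
    (∀ x ∈ C, ∀ t ∈ Set.Ioo (lo x) (hi x), (α (x 0) < t ∧ t < β (x 0)) ∧ (Fin.snoc x t : Fin 2 → ℝ) ∉ Z) →
    ∃ (Bd : KZ.IntegralRep 2) (b : KZ.IntegralRep 1), Bd.domain = KZlog.band C lo hi ∧ Bd.domain ⊆ r.domain ∧
      Bd.integrand = r.integrand ∧ b.domain = C ∧ (b.integrand = fun x => F (Fin.snoc x (hi x)) - F (Fin.snoc x (lo x))) ∧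
      KZ.of Bd - KZ.of b ∈ KZ.newtonLeibnizRel :=
  -- LANDED verbatim by the parallel lead of crux stmt-17657 (p146146): Theorems/IsogenyCertificatesGenusTwoRealPeriodCellStubSubband.lean
  Summit.KontsevichZagierPeriods.IsogenyCertificates.GenusTwoRealPeriodCellLine.stub_subband

/-- GREEN STUB 3 (the ENGINE, assembled): Newton–Leibniz down a closed band `{a₀ ≤ x ≤ a₁, α x ≤ y ≤ β x}` off a
`ℚ`-semialgebraic null set `Z`, from GREEN STUBS 1–2: cut along the cylinders of the adapted decomposition (rule 1a; null
cylinders and section graphs dropped), one sub-band move per `B`-band (stub 2; the `B`-bands avoid `Z` because a band over a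
positive-measure cell has positive measure), telescope the base pieces over each cell (rule 1b: the `B`-bands tile `(α x, β x)` up
to the section values, so `Σ_{j∈B} (F(ξ_j) − F(ξ_{j−1})) = F(β) − F(α)` on the cell), and glue the cells of `(a₀, a₁)` (rule 1a).
Template: `KZ.of_sub_of_mem_relations_groundLast` / `_cell`. This IS `stub_bandNewtonLeibniz` of stmt-4990. [cite: KontsevichZagier2001, §1.2 rules (1),(3)] -/
theorem stub_bandNewtonLeibniz_of_cad_of_subband :
    (∀ {n : ℕ} {σ τ : Set (Fin (n + 1) → ℝ)}, IsSemialgebraic ℚ σ → IsSemialgebraic ℚ τ →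
      ∃ (𝒮 : Finset (Set (Fin n → ℝ))) (l : Set (Fin n → ℝ) → ℕ) (ξ : (S : Set (Fin n → ℝ)) → Fin (l S) → (Fin n → ℝ) → ℝ),
        Literature.ModelTheory.ExponentialFields.IsCylindricalDecomposition ℚ n 𝒮 ∧
        (∀ S ∈ 𝒮, ∀ j, IsSemialgebraicFunOn ℚ S (ξ S j)) ∧ (∀ S ∈ 𝒮, ∀ x ∈ S, StrictMono fun j => ξ S j x) ∧
        (∀ S ∈ 𝒮, ∀ j, Literature.ModelTheory.ExponentialFields.bandOver S (ξ S) j ⊆ τ ∨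
          Disjoint (Literature.ModelTheory.ExponentialFields.bandOver S (ξ S) j) τ) ∧
        ∀ S ∈ 𝒮, ∃ B : Finset (Fin (l S + 1)), (∀ j ∈ B, Literature.ModelTheory.ExponentialFields.bandOver S (ξ S) j ⊆ σ) ∧
          ∀ x ∈ S, ∀ t : ℝ, (Fin.snoc x t : Fin (n + 1) → ℝ) ∈ σ → (∃ j, t = ξ S j x) ∨
            ∃ j ∈ B, Literature.ModelTheory.ExponentialFields.bandLower (ξ S) j x < t ∧
              (t : EReal) < Literature.ModelTheory.ExponentialFields.bandUpper (ξ S) j x) →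
    (∀ (a₀ a₁ : ℚ) (α β : ℝ → ℝ) (F : (Fin 2 → ℝ) → ℝ) (Z : Set (Fin 2 → ℝ))
      (r : KZ.IntegralRep 2), r.domain = {p : Fin 2 → ℝ | p 0 ∈ Set.Icc (a₀ : ℝ) a₁ ∧ α (p 0) ≤ p 1 ∧ p 1 ≤ β (p 0)} →
      IsSemialgebraicFunOn ℚ r.domain F → (∃ M : ℝ, ∀ p ∈ r.domain, |F p| ≤ M) →
      (∀ t ∈ Set.Ioo (a₀ : ℝ) a₁, ContinuousOn (fun s : ℝ => F ![t, s]) (Set.Icc (α t) (β t))) →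
      (∀ p ∈ r.domain, p 0 ∈ Set.Ioo (a₀ : ℝ) a₁ → α (p 0) < p 1 → p 1 < β (p 0) → p ∉ Z →
        HasDerivAt (fun s : ℝ => F ![p 0, s]) (r.integrand p) (p 1)) →
      ∀ {C : Set (Fin 1 → ℝ)}, IsSemialgebraic ℚ C → C ⊆ {x | x 0 ∈ Set.Ioo (a₀ : ℝ) a₁} →
      ∀ {lo hi : (Fin 1 → ℝ) → ℝ}, IsSemialgebraicFunOn ℚ C lo → IsSemialgebraicFunOn ℚ C hi → (∀ x ∈ C, lo x < hi x) →
      (∀ x ∈ C, ∀ t ∈ Set.Ioo (lo x) (hi x), (α (x 0) < t ∧ t < β (x 0)) ∧ (Fin.snoc x t : Fin 2 → ℝ) ∉ Z) →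
      ∃ (Bd : KZ.IntegralRep 2) (b : KZ.IntegralRep 1), Bd.domain = KZlog.band C lo hi ∧ Bd.domain ⊆ r.domain ∧
        Bd.integrand = r.integrand ∧ b.domain = C ∧ (b.integrand = fun x => F (Fin.snoc x (hi x)) - F (Fin.snoc x (lo x))) ∧
        KZ.of Bd - KZ.of b ∈ KZ.newtonLeibnizRel) →
    ∀ (a₀ a₁ : ℚ) (α β : ℝ → ℝ) (F : (Fin 2 → ℝ) → ℝ) (Z : Set (Fin 2 → ℝ)) (r : KZ.IntegralRep 2), a₀ < a₁ →
      IsSemialgebraicFunOn ℚ {z : Fin 1 → ℝ | z 0 ∈ Set.Ioo (a₀ : ℝ) a₁} (fun z => α (z 0)) →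
      IsSemialgebraicFunOn ℚ {z : Fin 1 → ℝ | z 0 ∈ Set.Ioo (a₀ : ℝ) a₁} (fun z => β (z 0)) →
      (∀ t ∈ Set.Ioo (a₀ : ℝ) a₁, α t ≤ β t) →
      r.domain = {p : Fin 2 → ℝ | p 0 ∈ Set.Icc (a₀ : ℝ) a₁ ∧ α (p 0) ≤ p 1 ∧ p 1 ≤ β (p 0)} →
      IsSemialgebraicFunOn ℚ r.domain F → (∃ M : ℝ, ∀ p ∈ r.domain, |F p| ≤ M) →
      (∀ t ∈ Set.Ioo (a₀ : ℝ) a₁, ContinuousOn (fun s : ℝ => F ![t, s]) (Set.Icc (α t) (β t))) →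
      IsSemialgebraic ℚ Z → volume Z = 0 →
      (∀ p ∈ r.domain, p 0 ∈ Set.Ioo (a₀ : ℝ) a₁ → α (p 0) < p 1 → p 1 < β (p 0) → p ∉ Z →
        HasDerivAt (fun s : ℝ => F ![p 0, s]) (r.integrand p) (p 1)) →
      ∃ r' : KZ.IntegralRep 1, r'.domain = {z : Fin 1 → ℝ | z 0 ∈ Set.Ioo (a₀ : ℝ) a₁} ∧
        (∀ z ∈ r'.domain, r'.integrand z = F ![z 0, β (z 0)] - F ![z 0, α (z 0)]) ∧
        KZ.of r - KZ.of r' ∈ KZ.relations :=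
  -- LANDED (p148147): Theorems/FermatIsogenyBetaLinearSectorStubBandNewtonLeibnizEngine.lean
  Summit.KontsevichZagierPeriods.FermatIsogeny.BetaLinearSector.stub_bandNewtonLeibniz_of_cad_of_subband

/-- GREEN STUB 4 (Green's formula on the native triangle from the engine): if Newton–Leibniz down a band off a null set is
available (GREEN STUB 3's conclusion), every instance `[∫A(t,0)] + [∫(B−A)(1−t,t)] − [∫B(0,t)]` of the typed Green generator of
stmt-10042 (`A da + B db` with a `C¹` potential on the open triangle, `A, B` continuous and `ℚ`-semialgebraic on the closed one)
lies in `KZ.relations`: the bulk `[Δ, ∂_b A]` exists (`PlanarAreas.stub_fibreDerivSemialgebraic`, `stub_derivIntegrable`), equals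
`[∫₀¹ A(a,1−a) − A(a,0) da]` by the engine along `b` (exceptional set from `PlanarAreas.stub_mixedPartials`), and — after the swap
move `PlanarAreas.stub_swap`, `Δ` being swap-invariant and `∂_b A = ∂_a B` a.e. — also `[∫₀¹ B(1−b,b) − B(0,b) db]`; the reflection
`t ↦ 1 − t` (rule 2) and rule 1b finish. [cite: KontsevichZagier2001, §1.2 rules (1)–(3)] -/
theorem stub_greenInRelations_of_bandNewtonLeibniz :
    (∀ (a₀ a₁ : ℚ) (α β : ℝ → ℝ) (F : (Fin 2 → ℝ) → ℝ) (Z : Set (Fin 2 → ℝ)) (r : KZ.IntegralRep 2), a₀ < a₁ →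
      IsSemialgebraicFunOn ℚ {z : Fin 1 → ℝ | z 0 ∈ Set.Ioo (a₀ : ℝ) a₁} (fun z => α (z 0)) →
      IsSemialgebraicFunOn ℚ {z : Fin 1 → ℝ | z 0 ∈ Set.Ioo (a₀ : ℝ) a₁} (fun z => β (z 0)) →
      (∀ t ∈ Set.Ioo (a₀ : ℝ) a₁, α t ≤ β t) →
      r.domain = {p : Fin 2 → ℝ | p 0 ∈ Set.Icc (a₀ : ℝ) a₁ ∧ α (p 0) ≤ p 1 ∧ p 1 ≤ β (p 0)} →
      IsSemialgebraicFunOn ℚ r.domain F → (∃ M : ℝ, ∀ p ∈ r.domain, |F p| ≤ M) →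
      (∀ t ∈ Set.Ioo (a₀ : ℝ) a₁, ContinuousOn (fun s : ℝ => F ![t, s]) (Set.Icc (α t) (β t))) →
      IsSemialgebraic ℚ Z → volume Z = 0 →
      (∀ p ∈ r.domain, p 0 ∈ Set.Ioo (a₀ : ℝ) a₁ → α (p 0) < p 1 → p 1 < β (p 0) → p ∉ Z →
        HasDerivAt (fun s : ℝ => F ![p 0, s]) (r.integrand p) (p 1)) →
      ∃ r' : KZ.IntegralRep 1, r'.domain = {z : Fin 1 → ℝ | z 0 ∈ Set.Ioo (a₀ : ℝ) a₁} ∧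
        (∀ z ∈ r'.domain, r'.integrand z = F ![z 0, β (z 0)] - F ![z 0, α (z 0)]) ∧
        KZ.of r - KZ.of r' ∈ KZ.relations) →
    ∀ g ∈ Summit.KontsevichZagierPeriods.SymplecticScissors.RealOnePeriodRelationsNegative.greenSet,
      g ∈ Literature.NumberTheory.Transcendental.KZ.relations :=
  -- LANDED (p148014): Theorems/FermatIsogenyBetaLinearSectorStubGreenOfEngine.lean
  Summit.KontsevichZagierPeriods.FermatIsogeny.BetaLinearSector.stub_greenInRelations_of_bandNewtonLeibniz

/-! ## The composition (sorry-free) -/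

/-- GREEN, assembled: every instance of the typed Green generator lies in `KZ.relations`. -/
theorem greenInRelations :
    ∀ g ∈ Summit.KontsevichZagierPeriods.SymplecticScissors.RealOnePeriodRelationsNegative.greenSet,
      g ∈ Literature.NumberTheory.Transcendental.KZ.relations :=
  stub_greenInRelations_of_bandNewtonLeibniz
    (stub_bandNewtonLeibniz_of_cad_of_subband stub_bandNewtonLeibniz_cad stub_bandNewtonLeibniz_subband)

/-- `M₁ = closure (1a ∪ 1b ∪ 2 ∪ Green) ≤ KZ.relations` as soon as the Green generator lies in the relations.
[cite: KontsevichZagier2001, §1.2] -/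
theorem M₁_le_relations
    (hG : ∀ g ∈ Summit.KontsevichZagierPeriods.SymplecticScissors.RealOnePeriodRelationsNegative.greenSet,
      g ∈ Literature.NumberTheory.Transcendental.KZ.relations) :
    M₁ ≤ KZ.relations := by
  refine (AddSubgroup.closure_le _).mpr ?_
  rintro c (((hc | hc) | hc) | hc)
  · exact KZ.domainAddRel_subset_relations hc
  · exact KZ.integrandAddRel_subset_relations hc
  · exact KZ.changeOfVariablesRel_subset_relations hc
  · exact hG c hc

/-- The apex implies the sector hypothesis on Fermat beta-arc symbols (strict weakening). [cite: HuberWustholz2022, Thm 13.3 (2)] -/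
theorem huberWustholzBetaArcs_of (h : HuberWustholzCurvePeriods) :
    ∀ C : PeriodSymbol →₀ ℂ, (∀ σ, IsAlgebraic ℚ (C σ)) → (∀ σ ∈ C.support, IsBetaArcSymbol σ) →
      evalCombination C = 0 →
      ∃ (k : ℕ) (ρ : Fin k → (PeriodSymbol →₀ ℂ)) (a : Fin k → ℂ),
        (∀ l, IsElementaryRelation (ρ l)) ∧ (∀ l, IsAlgebraic ℚ (a l)) ∧ C = ∑ l, a l • ρ l :=
  fun C hC _ h0 => h C hC h0

/-- CELLS of the layer (bookkeeping): every `c ∈ closure betaGens` is, modulo `M₁` (indeed exactly), a `ℤ`-combination of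
beta cells. [cite: KontsevichZagier2001, §1.2] -/
theorem betaCells : ∀ c : KZ.FormalRep, c ∈ AddSubgroup.closure betaGens →
    ∃ N : KZ.IntegralRep 1 →₀ ℤ, (∀ ρ ∈ N.support, ρ ∈ betaCellSet) ∧ c - N.sum (fun ρ m => m • KZ.of ρ) ∈ M₁ := by
  classical
  intro c hc
  refine AddSubgroup.closure_induction (p := fun c _ => ∃ N : KZ.IntegralRep 1 →₀ ℤ,
      (∀ ρ ∈ N.support, ρ ∈ betaCellSet) ∧ c - N.sum (fun ρ m => m • KZ.of ρ) ∈ M₁) ?_ ?_ ?_ ?_ hc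
  · rintro _ ⟨r, hr, rfl⟩
    refine ⟨Finsupp.single r 1, fun ρ hρ => ?_, ?_⟩
    · rw [Finsupp.support_single _ one_ne_zero, Finset.mem_singleton] at hρ
      subst hρ
      exact hr
    · rw [Cells.combo_single, sub_self]
      exact M₁.zero_mem
  · exact ⟨0, by simp, by simp [M₁.zero_mem]⟩
  · rintro c c' _ _ ⟨N, hN, hcN⟩ ⟨N', hN', hcN'⟩
    refine ⟨N + N', fun ρ hρ => ?_, ?_⟩
    · rcases Finset.mem_union.mp (Finsupp.support_add hρ) with h | h
      · exact hN ρ h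
      · exact hN' ρ h
    · rw [Cells.combo_add]
      convert M₁.add_mem hcN hcN' using 1
      abel
  · rintro c _ ⟨N, hN, hcN⟩
    refine ⟨-N, fun ρ hρ => hN ρ (by simpa [Finsupp.support_neg] using hρ), ?_⟩
    rw [Cells.combo_neg]
    convert M₁.neg_mem hcN using 1
    abel

/-- ARCS of the layer (GLUE STUB held by the lead: the `harcs` hypothesis of `SectorGlue.realOnePeriodRelations_of_sector` for
beta cells and Fermat symbols), from the three Fermat stubs (pattern `EllipticLayer.ellArcs`): a beta cell `[c·t^{a-1}(1-t)^{b-1}]`, `a = r/N`, `b = s/N`, is modulo `M₁` the real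
realisation of the ONE symbol `(F_N, ω_{r,s}, γ_N)` with coefficient `−cN`, and has the same value.
[cite: HuberWustholz2022, §3.3.1] [cite: Gross1978, §1] -/
theorem stub_betaArcs : ∀ ρ : KZ.IntegralRep 1, ρ ∈ betaCellSet →
    ∃ (C : PeriodSymbol →₀ ℂ) (R : PeriodSymbol → KZ.IntegralRep 1), (∀ σ, IsAlgebraic ℚ (C σ)) ∧
      (∀ σ ∈ C.support, IsBetaArcSymbol σ) ∧
      (∀ σ ∈ C.support, IsSemialgebraicMapOn ℚ {z : Fin 1 → ℝ | z 0 ∈ Set.Icc (0 : ℝ) 1}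
        (fun z => Fin.append (fun i => (σ.γ.toFun (z 0) i).re) (fun i => (σ.γ.toFun (z 0) i).im))) ∧
      (∀ σ ∈ C.support, (R σ).domain = {z | z 0 ∈ Set.Ioo (0 : ℝ) 1} ∧ ∀ z ∈ (R σ).domain, (R σ).integrand z =
        (C σ * ∑ i, MvPolynomial.eval (σ.γ.toFun (z 0)) (σ.ω i) * deriv (fun u => σ.γ.toFun u i) (z 0)).re) ∧
      evalCombination C = ((ρ.value : ℝ) : ℂ) ∧ KZ.of ρ - ∑ σ ∈ C.support, KZ.of (R σ) ∈ M₁ := by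
  classical
  rintro ρ ⟨a, b, c, ha, hb, hc, hdom, hint⟩
  -- set integrals over the unit-interval domain are interval integrals
  have value_of_unitCell : ∀ (ρ : KZ.IntegralRep 1), ρ.domain = {z | z 0 ∈ Set.Ioo (0 : ℝ) 1} →
      ρ.value = ∫ t in (0 : ℝ)..1, ρ.integrand (fun _ => t) := by
    intro ρ hdom
    rw [KZ.IntegralRep.value, hdom]
    have h := Summit.KontsevichZagierPeriods.SymplecticScissors.RealOnePeriodRelationsNegative.setIntegral_unitDom
      (fun t => ρ.integrand (fun _ => t))
    rw [← h]
    refine setIntegral_congr_fun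
      Summit.KontsevichZagierPeriods.SymplecticScissors.RealOnePeriodRelationsNegative.measurableSet_unitDom
      (fun z _ => ?_)
    show ρ.integrand z = ρ.integrand (fun _ => z 0)
    congr 1
    exact KZ.eq_const_apply_zero z
  -- the degenerate cell `c = 0`: the empty combination
  by_cases hc0 : c = 0
  · have hρ0 : ∀ z ∈ ρ.domain, ρ.integrand z = 0 := fun z hz => by rw [hint hz, hc0]; simp
    have hM : KZ.of ρ ∈ M₁ := by
      have h1b : KZ.of ρ - KZ.of ρ - KZ.of ρ ∈ M₁ :=
        AddSubgroup.subset_closure (Or.inl (Or.inl (Or.inr ⟨1, ρ, ρ, ρ, rfl, rfl,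
          fun z hz => by simp [Pi.add_apply, hρ0 z hz], rfl⟩)))
      have : KZ.of ρ = -(KZ.of ρ - KZ.of ρ - KZ.of ρ) := by abel
      rw [this]
      exact M₁.neg_mem h1b
    have hval : ρ.value = 0 := by
      rw [KZ.IntegralRep.value]
      exact setIntegral_eq_zero_of_forall_eq_zero hρ0
    refine ⟨0, fun _ => ρ, fun _ => by simpa using isAlgebraic_zero, by simp, by simp, by simp, ?_, ?_⟩
    · simp [evalCombination, hval]
    · simpa using hM
  -- level `N` and numerators: `a = r/N`, `b = s/N`
  obtain ⟨N, r, s, hN, hr, hs, haN, hbN⟩ : ∃ N r s : ℕ, 1 ≤ N ∧ 1 ≤ r ∧ 1 ≤ s ∧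
      (a : ℝ) = (r : ℝ) / N ∧ (b : ℝ) = (s : ℝ) / N := by
    refine ⟨a.den * b.den, a.num.toNat * b.den, b.num.toNat * a.den, Nat.one_le_iff_ne_zero.2
      (Nat.mul_ne_zero a.den_nz b.den_nz), ?_, ?_, ?_, ?_⟩
    · exact Nat.one_le_iff_ne_zero.2 (Nat.mul_ne_zero (by
        have := Rat.num_pos.2 ha; omega) b.den_nz)
    · exact Nat.one_le_iff_ne_zero.2 (Nat.mul_ne_zero (by
        have := Rat.num_pos.2 hb; omega) a.den_nz)
    · have hnum : ((a.num.toNat : ℕ) : ℝ) = (a.num : ℝ) := by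
        have h0 : 0 ≤ a.num := (Rat.num_pos.2 ha).le
        exact_mod_cast Int.toNat_of_nonneg h0
      have hq : (a : ℝ) = (a.num : ℝ) / (a.den : ℝ) := by exact_mod_cast (Rat.num_div_den a).symm
      rw [hq]
      push_cast
      rw [hnum]
      have hb0 : (b.den : ℝ) ≠ 0 := by exact_mod_cast b.den_nz
      have ha0 : (a.den : ℝ) ≠ 0 := by exact_mod_cast a.den_nz
      field_simp
    · have hnum : ((b.num.toNat : ℕ) : ℝ) = (b.num : ℝ) := by
        have h0 : 0 ≤ b.num := (Rat.num_pos.2 hb).le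
        exact_mod_cast Int.toNat_of_nonneg h0
      have hq : (b : ℝ) = (b.num : ℝ) / (b.den : ℝ) := by exact_mod_cast (Rat.num_div_den b).symm
      rw [hq]
      push_cast
      rw [hnum]
      have hb0 : (b.den : ℝ) ≠ 0 := by exact_mod_cast b.den_nz
      have ha0 : (a.den : ℝ) ≠ 0 := by exact_mod_cast a.den_nz
      field_simp
  -- symbol data
  obtain ⟨hZ, γ, hγ, hSA⟩ := stub_fermatSymbolData N hN
  set ω : Fin 2 → MvPolynomial (Fin 2) ℂ := ![X 0 ^ (r - 1) * X 1 ^ s, -(X 0 ^ r * X 1 ^ (s - 1))] with hωdef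
  have hω : ∀ i, HasAlgCoeffs (ω i) := by
    intro i
    fin_cases i
    · exact ((hasAlgCoeffs_X 0).pow (r - 1)).mul ((hasAlgCoeffs_X 1).pow s)
    · exact (((hasAlgCoeffs_X 0).pow r).mul ((hasAlgCoeffs_X 1).pow (s - 1))).neg
  set sy : PeriodSymbol := ⟨fermatCurve N, hZ, ω, hω, γ⟩ with hsy
  -- the coefficient `κ = −cN`
  set κ : ℂ := ((-(c * N) : ℝ) : ℂ) with hκdef
  have hκ : IsAlgebraic ℚ κ := (hc.mul (isAlgebraic_nat N)).neg.algebraMap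
  have hκ0 : κ ≠ 0 := by
    rw [hκdef, Ne, Complex.ofReal_eq_zero, neg_eq_zero, mul_eq_zero, not_or]
    exact ⟨hc0, by exact_mod_cast (Nat.one_le_iff_ne_zero.1 hN)⟩
  obtain ⟨R₁, hR₁dom, hR₁⟩ := stub_realises sy.Z sy.γ hSA sy.ω sy.ω_algebraic κ hκ
  -- the realisation integrand on `(0,1)`
  have hRint : ∀ t ∈ Set.Ioo (0 : ℝ) 1,
      (∑ i, MvPolynomial.eval (sy.γ.toFun t) (sy.ω i) * deriv (fun u => sy.γ.toFun u i) t) =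
        ((-((1 - t) ^ (r - 1) * t ^ (s - 1) * ((1 - t) ^ N + t ^ N) ^ (-((r:ℝ) + s) / N)) : ℝ) : ℂ) :=
    fun t ht => stub_fermatIntegrand N r s hN hr hs γ hγ t ht
  have hR₁' : ∀ z ∈ R₁.domain, R₁.integrand z =
      c * N * ((1 - z 0) ^ (r - 1) * (z 0) ^ (s - 1) * ((1 - z 0) ^ N + (z 0) ^ N) ^ (-((r:ℝ) + s) / N)) := by
    intro z hz
    have ht : z 0 ∈ Set.Ioo (0 : ℝ) 1 := by rw [hR₁dom] at hz; exact hz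
    rw [hR₁ z hz, hRint (z 0) ht, hκdef, ← Complex.ofReal_mul, Complex.ofReal_re]
    ring
  -- rule 2: `[ρ] − [R₁] ∈ M₁`
  have hsub : KZ.of ρ - KZ.of R₁ ∈ M₁ := by
    refine stub_fermatRealise N r s c hN hr hs hc ρ R₁ hdom (fun z hz => ?_) hR₁dom hR₁'
    rw [hint hz, haN, hbN]
  have hval : R₁.value = ρ.value := by
    have h := Summit.KontsevichZagierPeriods.SymplecticScissors.RealOnePeriodRelationsNegative.eval_eq_zero_of_mem_M₁ hsub
    rw [map_sub, KZ.eval_of, KZ.eval_of, sub_eq_zero] at h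
    exact h.symm
  refine ⟨Finsupp.single sy κ, fun _ => R₁, ?_, ?_, ?_, ?_, ?_, ?_⟩
  · intro t
    by_cases h : t = sy
    · subst h; simpa using hκ
    · rw [Finsupp.single_apply, if_neg (Ne.symm h)]; exact isAlgebraic_zero
  · intro t ht
    rw [Finsupp.support_single _ hκ0, Finset.mem_singleton] at ht
    subst ht
    exact ⟨N, r, s, hZ, γ, hω, hN, hr, hs, hγ, rfl⟩
  · intro t ht
    rw [Finsupp.support_single _ hκ0, Finset.mem_singleton] at ht
    subst ht
    exact hSA
  · intro t ht
    rw [Finsupp.support_single _ hκ0, Finset.mem_singleton] at ht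
    subst ht
    refine ⟨hR₁dom, fun z hz => ?_⟩
    rw [hR₁ z hz, Finsupp.single_eq_same]
  · -- the value: `κ · period sy = R₁.value = ρ.value`
    rw [evalCombination, Finsupp.sum_single_index (by simp), PeriodSymbol.period, ← hval,
      value_of_unitCell R₁ hR₁dom, ← intervalIntegral.integral_ofReal, ← intervalIntegral.integral_const_mul,
      intervalIntegral.integral_of_le zero_le_one, intervalIntegral.integral_of_le zero_le_one,
      integral_Ioc_eq_integral_Ioo, integral_Ioc_eq_integral_Ioo]
    refine setIntegral_congr_fun measurableSet_Ioo fun t ht => ?_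
    have hz : (fun _ : Fin 1 => t) ∈ R₁.domain := by rw [hR₁dom]; exact ht
    rw [hR₁ _ hz]
    show κ * (∑ i, MvPolynomial.eval (sy.γ.toFun t) (sy.ω i) * deriv (fun u => sy.γ.toFun u i) t) = _
    rw [hRint t ht, hκdef, ← Complex.ofReal_mul, Complex.ofReal_re]
  · rw [Finsupp.support_single _ hκ0, Finset.sum_singleton]
    exact hsub

/-- **THE FERMAT LAYER**: from HW 13.3 (2) on Fermat symbols, every `ℤ`-combination of beta cells with vanishing value lies in
`M₁` — `SectorGlue.realOnePeriodRelations_of_sector` fed with `betaCells` and `betaArcs`. [cite: HuberWustholz2022, Thm 13.3 (2)] -/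
theorem fermatLayer
    (hHW : ∀ C : PeriodSymbol →₀ ℂ, (∀ σ, IsAlgebraic ℚ (C σ)) → (∀ σ ∈ C.support, IsBetaArcSymbol σ) →
      evalCombination C = 0 →
      ∃ (k : ℕ) (ρ : Fin k → (PeriodSymbol →₀ ℂ)) (a : Fin k → ℂ),
        (∀ l, IsElementaryRelation (ρ l)) ∧ (∀ l, IsAlgebraic ℚ (a l)) ∧ C = ∑ l, a l • ρ l) :
    ∀ c : KZ.FormalRep, c ∈ AddSubgroup.closure betaGens → KZ.eval c = 0 → c ∈ M₁ :=
  Summit.KontsevichZagierPeriods.SymplecticScissors.RealOnePeriodRelations.SectorGlue.realOnePeriodRelations_of_sector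
    betaGens (· ∈ betaCellSet) IsBetaArcSymbol hHW betaCells stub_betaArcs

set_option quotPrecheck false in
/-- The crux `BetaLinearSector` UNFOLDED VERBATIM (so that exactly one theorem of this file, `BetaLinearSector_of`, concludes
the crux by its route name; internal to the skeleton). -/
local notation "BetaLinearSectorUnfolded" =>
  (∀ (a b a' b' : ℚ) (c : ℝ), 0 < a → 0 < b → 0 < a' → 0 < b' → IsAlgebraic ℚ c →
    ∀ (r r' : Literature.NumberTheory.Transcendental.KZ.IntegralRep 1),
      r.domain = {x | x 0 ∈ Set.Ioo (0:ℝ) 1} →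
      Set.EqOn r.integrand (fun x => (x 0) ^ ((a:ℝ) - 1) * (1 - x 0) ^ ((b:ℝ) - 1)) r.domain →
      r'.domain = {x | x 0 ∈ Set.Ioo (0:ℝ) 1} →
      Set.EqOn r'.integrand (fun x => c * (x 0) ^ ((a':ℝ) - 1) * (1 - x 0) ^ ((b':ℝ) - 1)) r'.domain →
      r.value = r'.value → Literature.NumberTheory.Transcendental.KZ.Equivalent r r')

/-- The crux (unfolded) from the Fermat layer and Green: the two hypothesis representations are beta cells (`c = 1` on the
left), `[r] − [r'] ∈ closure betaGens` has value `0`, so it lies in `M₁` by the layer, and `M₁ ≤ relations` by Green.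
[cite: HuberWustholz2022, Thm 13.3 (2)] -/
theorem betaLinearSector_of_layer
    (hHW : ∀ C : PeriodSymbol →₀ ℂ, (∀ σ, IsAlgebraic ℚ (C σ)) → (∀ σ ∈ C.support, IsBetaArcSymbol σ) →
      evalCombination C = 0 →
      ∃ (k : ℕ) (ρ : Fin k → (PeriodSymbol →₀ ℂ)) (a : Fin k → ℂ),
        (∀ l, IsElementaryRelation (ρ l)) ∧ (∀ l, IsAlgebraic ℚ (a l)) ∧ C = ∑ l, a l • ρ l)
    (hG : ∀ g ∈ Summit.KontsevichZagierPeriods.SymplecticScissors.RealOnePeriodRelationsNegative.greenSet,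
      g ∈ Literature.NumberTheory.Transcendental.KZ.relations) :
    BetaLinearSectorUnfolded := by
  intro a b a' b' c ha hb ha' hb' hc r r' hd hi hd' hi' hv
  have hr : r ∈ betaCellSet := by
    refine ⟨a, b, 1, ha, hb, isAlgebraic_one, hd, fun x hx => ?_⟩
    rw [hi hx]
    simp only [one_mul]
  have hr' : r' ∈ betaCellSet := ⟨a', b', c, ha', hb', hc, hd', hi'⟩
  have hmem : KZ.of r - KZ.of r' ∈ AddSubgroup.closure betaGens :=
    AddSubgroup.sub_mem _ (AddSubgroup.subset_closure ⟨r, hr, rfl⟩) (AddSubgroup.subset_closure ⟨r', hr', rfl⟩)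
  have heval : KZ.eval (KZ.of r - KZ.of r') = 0 := by
    rw [map_sub, KZ.eval_of, KZ.eval_of, hv, sub_self]
  exact M₁_le_relations hG (fermatLayer hHW _ hmem heval)

/-- **Skeleton theorem** (concludes the crux BY NAME): `BetaLinearSector` from the registered stubs — the apex (restricted to
Fermat symbols), the Fermat normalisation (inside `betaArcs`) and Green. -/
theorem BetaLinearSector_of : BetaLinearSector :=
  betaLinearSector_of_layer (huberWustholzBetaArcs_of stub_huberWustholzCurvePeriods) greenInRelations

/-! ## Record: the containing line `hw-real-transport` (apex + Green ⇒ crux, through stmt-10042's landed composition) -/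

/-- Conjecture 1 for ALL pairs of one-dimensional representations from the apex and Green: Huber–Wüstholz for curve-type
periods gives `RealOnePeriodRelations` (landed composition of stmt-10042), so `[r] − [r'] ∈ M₁` whenever `r.value = r'.value`;
and `M₁ ≤ relations` by Green. [cite: HuberWustholz2022, Thm 13.3 (2)] -/
theorem equivalent_of_value_eq (hHW : HuberWustholzCurvePeriods)
    (hG : ∀ g ∈ Summit.KontsevichZagierPeriods.SymplecticScissors.RealOnePeriodRelationsNegative.greenSet,
      g ∈ Literature.NumberTheory.Transcendental.KZ.relations)
    (r r' : KZ.IntegralRep 1) (hv : r.value = r'.value) : KZ.Equivalent r r' := by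
  have hR := crux_iff.mp
    (Summit.KontsevichZagierPeriods.SymplecticScissors.RealOnePeriodRelations.realOnePeriodRelations_of_huberWustholzCurvePeriods
      hHW)
  have hmem : KZ.of r - KZ.of r' ∈ H₁ :=
    H₁.sub_mem (AddSubgroup.subset_closure ⟨r, rfl⟩) (AddSubgroup.subset_closure ⟨r', rfl⟩)
  have heval : KZ.eval (KZ.of r - KZ.of r') = 0 := by
    rw [map_sub, KZ.eval_of, KZ.eval_of, hv, sub_self]
  exact M₁_le_relations hG (hR _ hmem heval)

/-- The crux from the apex and Green alone (line `hw-real-transport`, contained in this one). [cite: HuberWustholz2022, Thm 13.3 (2)] -/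
theorem BetaLinearSector_of_subs : HuberWustholzCurvePeriods →
    (∀ g ∈ Summit.KontsevichZagierPeriods.SymplecticScissors.RealOnePeriodRelationsNegative.greenSet,
      g ∈ Literature.NumberTheory.Transcendental.KZ.relations) →
    BetaLinearSectorUnfolded := by
  intro hHW hG a b a' b' c _ _ _ _ _ r r' _ _ _ _ hv
  exact equivalent_of_value_eq hHW hG r r' hv

/-! # Section `Sector` (reshape 2, lead c4): THE FERMAT REFLECTION CLASS AT ALL LEVELS (transcendence-free Case 1 of the crux)

For positive rationals `a, b` with `a + b < 1`: `B(a,b) = [sin π(a+b)/sin πa] · B(1−a−b, b)` — Koblitz–Rohrlich's "obvious"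
coincidences coming from the S₃-symmetry of the Fermat curve (exchange of the cusp groups `x = 0` and `z = 0`).  Realised AS
MOVES uniformly in `N` by an EXPLICIT elementary decomposition (R1)–(R5): Cauchy's theorem on the sector `{0 ≤ arg x ≤ π/N}` of one
sheet of `F_N(ℂ)` (corners: the cusps `O = (0,1)`, `P = (1,0)`, `P∞`), written as two null-homotopic loops — one in the affine
chart `F_N` (stub H1), one in the chart at infinity `g₂(F_N ∖ {x = 0})` (stub H2) — glued along the frontier by (R4)-transport
(stubs T1, T2, and SW for `g₂ ∘ swap`), giving the three-term UPPER SECTOR RELATION (stub U)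
`(ω_{r,s}, γ_N) − ε̄^s (ω_{t,s}, γ_N) − ε^r (ω_{r,t}, γ_N) ∼ 0` (`ε = e^{iπ/N}`, `t = N − r − s`; on periods
`B(a,b) = e^{−iπb}B(t/N,b) + e^{iπa}B(a,t/N)`), then the TWO-TERM RELATION (stub TT) by eliminating `(ω_{r,t}, γ_N)` between the
`(r,s,t)`- and `(t,s,r)`-instances, and the KZ transfer (stub KZ) through the LANDED retraction `Θ`
(`SectorGlue.realOnePeriodRelations_of_sector` with the two-symbol sector, whose Huber–Wüstholz hypothesis is then a theorem)
and the landed Green lemma (`M₁ ≤ relations`).  All formulas numerically validated (N = 3,…,7; residuals ≤ 1e-11).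
ALL THIRTEEN SECTOR STUBS ARE LANDED (lead c4, 2026-08-17: p168450 p169354 p169593 p169536 p170022 p169714 p169799 p169535 p170784
p171016 p171372 p170907 p170921; aux p167705 p169090 p169816 p170247; residual dichotomy p171480): the rungs `stub_fermatReflectionRung` and
`betaLinearSector_fermatS3Class` (Theorems/FermatIsogenyBetaLinearSectorStubFermatReflectionRung.lean) are `--supports`; `BetaLinearSector_of`
above is unchanged (sorries of this file = 1 = the apex). -/

/-! ## Registered stubs of the sector (all statements over existing declarations; the objects are inlined)

Notation of the docstrings (inlined in the statements): `F_N = (⟨2, 1, ![X 0 ^ N + X 1 ^ N - 1]⟩ : CurveData)`;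
`ω_{r,s} = ![X 0 ^ (r-1) * X 1 ^ s, -(X 0 ^ r * X 1 ^ (s-1))]` (Rohrlich's form `x^{r-1}y^{s-1}(y dx − x dy)`);
`γ_N(t) = Q(t)^{-1/N}(1−t, t)`, `Q = (1−t)^N + t^N` (the radial real arc from `P = (1,0)` to `O = (0,1)`);
`ε = exp(iπ/N)`, `ε̄ = exp(−iπ/N)`; the SECTOR CHART `Y(z) = exp(−iπ/(2N))·(i(1 − z^N))^{1/N}` (principal power), so that
`Φ(z) = (z, Y z) ∈ F_N` parametrises the sheet of `F_N` over `{0 ≤ arg z^N ≤ π}` continuing the real arc; the FRONTIER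
`x_f(t) = (2−t)^{1/N} exp(iπt/N)` (`x_f^N = (2−t)e^{iπt}` runs through the upper half plane from `2` to `−1`);
the birational automorphisms `g₂(x,y) = (1/x, εy/x)` (fixes `P`, sends `P∞ ↦ O`) and `g₃(x,y) = (ε̄x/y, 1/y)` (fixes `O`, sends
`P∞ ↦ P`) of the projective Fermat curve, under which `ω_{r,s} = ε̄^s g₂^*ω_{t,s} = ε^r g₃^*ω_{r,t}`, `t = N − r − s`. -/

/-- SECTOR STUB B1 (the sector chart, analytic facts). For `N ≥ 1`: `Φ(z) = (z, Y z)` lies on `F_N`; `Y` is continuous on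
`S⁺ = {0 ≤ Im z^N}` and on `S⁻ = {Im u^N ≤ 0, |u^N| ≤ 1, u^N ≠ 1}` (the base `i(1 − z^N)` of the principal power stays off the
closed negative real axis), both star-shaped at `0`; the values of `Y` on the real arc, on the real branch `x > 1`
(`Y = ε̄ (x^N−1)^{1/N}`), on the rays `arg = ±π/N`, and the frontier identity `ε Y(x_f)/x_f = Y(1/x_f)` (both sides are `N`-th
roots of `1 − x_f^{−N}`, continuous in `t`, equal at `t = 0`); the chart memberships of the sector paths' first coordinates.
[cite: Gross1978, §1 (Rohrlich's appendix)] -/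
theorem stub_sectorChart : ∀ (N : ℕ), 3 ≤ N →
    (∀ z : ℂ, (![z, Complex.exp (-(↑Real.pi * Complex.I / (2 * (N : ℂ)))) * (Complex.I * (1 - z ^ N)) ^ ((N : ℂ)⁻¹)] :
        Fin 2 → ℂ) ∈ (⟨2, 1, ![X 0 ^ N + X 1 ^ N - 1]⟩ : CurveData).points) ∧
    ContinuousOn (fun z : ℂ => Complex.exp (-(↑Real.pi * Complex.I / (2 * (N : ℂ)))) * (Complex.I * (1 - z ^ N)) ^ ((N : ℂ)⁻¹))
      {z : ℂ | 0 ≤ (z ^ N).im} ∧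
    StarConvex ℝ (0 : ℂ) {z : ℂ | 0 ≤ (z ^ N).im} ∧
    ContinuousOn (fun z : ℂ => Complex.exp (-(↑Real.pi * Complex.I / (2 * (N : ℂ)))) * (Complex.I * (1 - z ^ N)) ^ ((N : ℂ)⁻¹))
      {u : ℂ | (u ^ N).im ≤ 0 ∧ ‖u ^ N‖ ≤ 1 ∧ u ^ N ≠ 1} ∧
    StarConvex ℝ (0 : ℂ) {u : ℂ | (u ^ N).im ≤ 0 ∧ ‖u ^ N‖ ≤ 1 ∧ u ^ N ≠ 1} ∧
    (∀ t ∈ Set.Icc (0:ℝ) 1,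
      Complex.exp (-(↑Real.pi * Complex.I / (2 * (N : ℂ)))) *
          (Complex.I * (1 - ((((1 - t) * ((1 - t) ^ N + t ^ N) ^ (-(1:ℝ) / N) : ℝ) : ℂ)) ^ N)) ^ ((N : ℂ)⁻¹) =
        ((t * ((1 - t) ^ N + t ^ N) ^ (-(1:ℝ) / N) : ℝ) : ℂ) ∧
      0 ≤ (((((1 - t) * ((1 - t) ^ N + t ^ N) ^ (-(1:ℝ) / N) : ℝ) : ℂ)) ^ N).im ∧
      (1 / 2 ≤ t → (((((1 - t) * ((1 - t) ^ N + t ^ N) ^ (-(1:ℝ) / N) : ℝ) : ℂ)) ^ N).im ≤ 0 ∧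
        ‖((((1 - t) * ((1 - t) ^ N + t ^ N) ^ (-(1:ℝ) / N) : ℝ) : ℂ)) ^ N‖ ≤ 1 ∧
        ((((1 - t) * ((1 - t) ^ N + t ^ N) ^ (-(1:ℝ) / N) : ℝ) : ℂ)) ^ N ≠ 1)) ∧
    (∀ u ∈ Set.Icc (0:ℝ) (1/2),
      Complex.exp (-(↑Real.pi * Complex.I / (2 * (N : ℂ)))) *
          (Complex.I * (1 - (((((1 - u) * ((1 - u) ^ N + u ^ N) ^ (-(1:ℝ) / N) : ℝ) : ℂ))⁻¹) ^ N)) ^ ((N : ℂ)⁻¹) =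
        Complex.exp (-(↑Real.pi * Complex.I / (N : ℂ))) * ((u * ((1 - u) ^ N + u ^ N) ^ (-(1:ℝ) / N) : ℝ) : ℂ) /
          ((((1 - u) * ((1 - u) ^ N + u ^ N) ^ (-(1:ℝ) / N) : ℝ) : ℂ)) ∧
      0 ≤ (((((((1 - u) * ((1 - u) ^ N + u ^ N) ^ (-(1:ℝ) / N) : ℝ) : ℂ))⁻¹) ^ N).im)) ∧
    (∀ v ∈ Set.Icc (1/2:ℝ) 1,
      Complex.exp (-(↑Real.pi * Complex.I / (2 * (N : ℂ)))) *
          (Complex.I * (1 - (Complex.exp (↑Real.pi * Complex.I / (N : ℂ)) *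
            ((((1 - v) * ((1 - v) ^ N + v ^ N) ^ (-(1:ℝ) / N) : ℝ) : ℂ)) /
            ((v * ((1 - v) ^ N + v ^ N) ^ (-(1:ℝ) / N) : ℝ) : ℂ)) ^ N)) ^ ((N : ℂ)⁻¹) =
        (((v * ((1 - v) ^ N + v ^ N) ^ (-(1:ℝ) / N) : ℝ) : ℂ))⁻¹ ∧
      0 ≤ ((Complex.exp (↑Real.pi * Complex.I / (N : ℂ)) *
            ((((1 - v) * ((1 - v) ^ N + v ^ N) ^ (-(1:ℝ) / N) : ℝ) : ℂ)) /
            ((v * ((1 - v) ^ N + v ^ N) ^ (-(1:ℝ) / N) : ℝ) : ℂ)) ^ N).im) ∧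
    (∀ u ∈ Set.Icc (0:ℝ) (1/2),
      Complex.exp (-(↑Real.pi * Complex.I / (2 * (N : ℂ)))) *
          (Complex.I * (1 - (Complex.exp (-(↑Real.pi * Complex.I / (N : ℂ))) *
            ((u * ((1 - u) ^ N + u ^ N) ^ (-(1:ℝ) / N) : ℝ) : ℂ) /
            ((((1 - u) * ((1 - u) ^ N + u ^ N) ^ (-(1:ℝ) / N) : ℝ) : ℂ))) ^ N)) ^ ((N : ℂ)⁻¹) =
        (((((1 - u) * ((1 - u) ^ N + u ^ N) ^ (-(1:ℝ) / N) : ℝ) : ℂ)))⁻¹ ∧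
      ((Complex.exp (-(↑Real.pi * Complex.I / (N : ℂ))) *
            ((u * ((1 - u) ^ N + u ^ N) ^ (-(1:ℝ) / N) : ℝ) : ℂ) /
            ((((1 - u) * ((1 - u) ^ N + u ^ N) ^ (-(1:ℝ) / N) : ℝ) : ℂ))) ^ N).im ≤ 0 ∧
      ‖(Complex.exp (-(↑Real.pi * Complex.I / (N : ℂ))) *
            ((u * ((1 - u) ^ N + u ^ N) ^ (-(1:ℝ) / N) : ℝ) : ℂ) /
            ((((1 - u) * ((1 - u) ^ N + u ^ N) ^ (-(1:ℝ) / N) : ℝ) : ℂ))) ^ N‖ ≤ 1 ∧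
      (Complex.exp (-(↑Real.pi * Complex.I / (N : ℂ))) *
            ((u * ((1 - u) ^ N + u ^ N) ^ (-(1:ℝ) / N) : ℝ) : ℂ) /
            ((((1 - u) * ((1 - u) ^ N + u ^ N) ^ (-(1:ℝ) / N) : ℝ) : ℂ))) ^ N ≠ 1) ∧
    (∀ t ∈ Set.Icc (0:ℝ) 1,
      0 ≤ ((((((2:ℝ) - t) ^ ((N:ℝ)⁻¹) : ℝ) : ℂ) * Complex.exp (↑Real.pi * Complex.I * (t : ℂ) / (N : ℂ))) ^ N).im ∧
      (((((((2:ℝ) - t) ^ ((N:ℝ)⁻¹) : ℝ) : ℂ) * Complex.exp (↑Real.pi * Complex.I * (t : ℂ) / (N : ℂ)))⁻¹) ^ N).im ≤ 0 ∧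
      ‖((((((2:ℝ) - t) ^ ((N:ℝ)⁻¹) : ℝ) : ℂ) * Complex.exp (↑Real.pi * Complex.I * (t : ℂ) / (N : ℂ)))⁻¹) ^ N‖ ≤ 1 ∧
      ((((((2:ℝ) - t) ^ ((N:ℝ)⁻¹) : ℝ) : ℂ) * Complex.exp (↑Real.pi * Complex.I * (t : ℂ) / (N : ℂ)))⁻¹) ^ N ≠ 1 ∧
      Complex.exp (↑Real.pi * Complex.I / (N : ℂ)) *
          (Complex.exp (-(↑Real.pi * Complex.I / (2 * (N : ℂ)))) *
            (Complex.I * (1 - (((((2:ℝ) - t) ^ ((N:ℝ)⁻¹) : ℝ) : ℂ) *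
              Complex.exp (↑Real.pi * Complex.I * (t : ℂ) / (N : ℂ))) ^ N)) ^ ((N : ℂ)⁻¹)) /
          (((((2:ℝ) - t) ^ ((N:ℝ)⁻¹) : ℝ) : ℂ) * Complex.exp (↑Real.pi * Complex.I * (t : ℂ) / (N : ℂ))) =
        Complex.exp (-(↑Real.pi * Complex.I / (2 * (N : ℂ)))) *
          (Complex.I * (1 - ((((((2:ℝ) - t) ^ ((N:ℝ)⁻¹) : ℝ) : ℂ) *
            Complex.exp (↑Real.pi * Complex.I * (t : ℂ) / (N : ℂ)))⁻¹) ^ N)) ^ ((N : ℂ)⁻¹)) :=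
  -- LANDED: Theorems/FermatIsogenyBetaLinearSector*
  Summit.KontsevichZagierPeriods.FermatIsogeny.BetaLinearSector.stub_sectorChart

/-- SECTOR STUB P (the five sector paths exist as `C¹` paths with algebraic end points on `F_N`, with the junction
equalities). Given the radial arc `γ = γ_N` (landed, `stub_fermatSymbolData`): `e₂ = g₂⁻¹∘γ(t/2)` (real branch `x ∈ [1, 2^{1/N}]`,
from `P` to `B″ = (2^{1/N}, ε̄)`), the frontier `f = Φ ∘ x_f` (from `B″` to `C″ = (ε, 2^{1/N})`), `e₃ = g₃⁻¹∘γ((1+t)/2)` (the ray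
`arg x = π/N`, from `C″` to `O`), and in the chart at infinity `d₃ = g₂∘e₃-analogue = (ε̄γ_y/γ_x, 1/γ_x)(t/2)` (from `O` to
`g₂(C″) = (ε̄, 2^{1/N})`) and `fI = g₂ ∘ f` (from `A = γ(1/2)` to `g₂(C″)`). All coordinates are quotients of the (nonvanishing)
coordinates of `γ`, or the explicit `x_f`, `Y(x_f)` (principal power of a base in the closed right half plane minus `0`).
[cite: Gross1978, §1 (Rohrlich's appendix)] -/
theorem stub_sectorPaths : ∀ (N : ℕ), 3 ≤ N →
    ∀ γ : CurvePath (⟨2, 1, ![X 0 ^ N + X 1 ^ N - 1]⟩ : CurveData),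
    (∀ t : ℝ, γ.toFun t = ![(((1 - t) * ((1 - t) ^ N + t ^ N) ^ (-(1:ℝ) / N) : ℝ) : ℂ),
      ((t * ((1 - t) ^ N + t ^ N) ^ (-(1:ℝ) / N) : ℝ) : ℂ)]) →
    ∃ (e₂ f e₃ d₃ f' γ₁ γ₂ : CurvePath (⟨2, 1, ![X 0 ^ N + X 1 ^ N - 1]⟩ : CurveData)),
      (∀ t : ℝ, e₂.toFun t = ![(γ.toFun (t / 2) 0)⁻¹,
        Complex.exp (-(↑Real.pi * Complex.I / (N : ℂ))) * γ.toFun (t / 2) 1 / γ.toFun (t / 2) 0]) ∧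
      (∀ t : ℝ, f.toFun t = ![((((2:ℝ) - t) ^ ((N:ℝ)⁻¹) : ℝ) : ℂ) * Complex.exp (↑Real.pi * Complex.I * (t : ℂ) / (N : ℂ)),
        Complex.exp (-(↑Real.pi * Complex.I / (2 * (N : ℂ)))) *
          (Complex.I * (1 - (((((2:ℝ) - t) ^ ((N:ℝ)⁻¹) : ℝ) : ℂ) *
            Complex.exp (↑Real.pi * Complex.I * (t : ℂ) / (N : ℂ))) ^ N)) ^ ((N : ℂ)⁻¹)]) ∧
      (∀ t : ℝ, e₃.toFun t = ![Complex.exp (↑Real.pi * Complex.I / (N : ℂ)) * γ.toFun ((1 + t) / 2) 0 / γ.toFun ((1 + t) / 2) 1,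
        (γ.toFun ((1 + t) / 2) 1)⁻¹]) ∧
      (∀ t : ℝ, d₃.toFun t = ![Complex.exp (-(↑Real.pi * Complex.I / (N : ℂ))) * γ.toFun (t / 2) 1 / γ.toFun (t / 2) 0,
        (γ.toFun (t / 2) 0)⁻¹]) ∧
      (∀ t : ℝ, f'.toFun t = ![(((((2:ℝ) - t) ^ ((N:ℝ)⁻¹) : ℝ) : ℂ) * Complex.exp (↑Real.pi * Complex.I * (t : ℂ) / (N : ℂ)))⁻¹,
        Complex.exp (↑Real.pi * Complex.I / (N : ℂ)) *
          (Complex.exp (-(↑Real.pi * Complex.I / (2 * (N : ℂ)))) *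
            (Complex.I * (1 - (((((2:ℝ) - t) ^ ((N:ℝ)⁻¹) : ℝ) : ℂ) *
              Complex.exp (↑Real.pi * Complex.I * (t : ℂ) / (N : ℂ))) ^ N)) ^ ((N : ℂ)⁻¹)) /
          (((((2:ℝ) - t) ^ ((N:ℝ)⁻¹) : ℝ) : ℂ) * Complex.exp (↑Real.pi * Complex.I * (t : ℂ) / (N : ℂ)))]) ∧
      (∀ t : ℝ, γ₁.toFun t = γ.toFun (t / 2)) ∧ (∀ t : ℝ, γ₂.toFun t = γ.toFun ((1 + t) / 2)) ∧
      e₂.toFun 0 = γ.toFun 0 ∧ e₂.toFun 1 = f.toFun 0 ∧ f.toFun 1 = e₃.toFun 0 ∧ e₃.toFun 1 = γ.toFun 1 ∧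
      d₃.toFun 0 = γ.toFun 1 ∧ d₃.toFun 1 = f'.toFun 1 ∧ f'.toFun 0 = γ.toFun (1 / 2) :=
  -- LANDED: Theorems/FermatIsogenyBetaLinearSector*
  Summit.KontsevichZagierPeriods.FermatIsogeny.BetaLinearSector.stub_sectorPaths

/-- SECTOR STUB H1 (the loop in the affine chart `Z = F_N` is null-homotopic ⇒ its symbol is `∼ 0`). Pure topology: if `Y` is
continuous on a set `S ⊆ ℂ` star-shaped at `0` with `Φ(z) = (z, Y z) ∈ F_N`, and four `C¹` paths `e₂, f, e₃, γ` on `F_N` lie on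
the chart over `S` (second coordinate = `Y` of the first, first coordinate in `S`) and form the loop
`γ(0) →e₂→ · →f→ · →e₃→ γ(1)` closed by `γ⁻`, then `(e₂) + (f) + (e₃) − (γ) ∼ 0`: the loop is `Φ ∘ (planar loop in S)`, `S` is
contractible (`StarConvex.contractibleSpace`), so the loop is null-homotopic in `F_N(ℂ)` (`Path.Homotopic.map`) and
`span_single_of_nullhomotopic`, `span_concat`, `span_single_add_single_reverse` conclude.
[cite: HuberWustholz2022, §3.3.1 (pp. 42–44)] -/
theorem stub_sectorLoopZ : ∀ (N : ℕ), 1 ≤ N → ∀ (S : Set ℂ), StarConvex ℝ (0 : ℂ) S →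
    ContinuousOn (fun z : ℂ => Complex.exp (-(↑Real.pi * Complex.I / (2 * (N : ℂ)))) * (Complex.I * (1 - z ^ N)) ^ ((N : ℂ)⁻¹)) S →
    (∀ z : ℂ, (![z, Complex.exp (-(↑Real.pi * Complex.I / (2 * (N : ℂ)))) * (Complex.I * (1 - z ^ N)) ^ ((N : ℂ)⁻¹)] :
        Fin 2 → ℂ) ∈ (⟨2, 1, ![X 0 ^ N + X 1 ^ N - 1]⟩ : CurveData).points) →
    ∀ (hZ : (⟨2, 1, ![X 0 ^ N + X 1 ^ N - 1]⟩ : CurveData).IsSmoothAffineCurve)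
      (ω : Fin 2 → MvPolynomial (Fin 2) ℂ) (hω : ∀ i, HasAlgCoeffs (ω i))
      (γ e₂ f e₃ : CurvePath (⟨2, 1, ![X 0 ^ N + X 1 ^ N - 1]⟩ : CurveData)),
    (∀ t ∈ Set.Icc (0:ℝ) 1, γ.toFun t = ![γ.toFun t 0, Complex.exp (-(↑Real.pi * Complex.I / (2 * (N : ℂ)))) *
        (Complex.I * (1 - (γ.toFun t 0) ^ N)) ^ ((N : ℂ)⁻¹)] ∧ γ.toFun t 0 ∈ S) →
    (∀ t ∈ Set.Icc (0:ℝ) 1, e₂.toFun t = ![e₂.toFun t 0, Complex.exp (-(↑Real.pi * Complex.I / (2 * (N : ℂ)))) *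
        (Complex.I * (1 - (e₂.toFun t 0) ^ N)) ^ ((N : ℂ)⁻¹)] ∧ e₂.toFun t 0 ∈ S) →
    (∀ t ∈ Set.Icc (0:ℝ) 1, f.toFun t = ![f.toFun t 0, Complex.exp (-(↑Real.pi * Complex.I / (2 * (N : ℂ)))) *
        (Complex.I * (1 - (f.toFun t 0) ^ N)) ^ ((N : ℂ)⁻¹)] ∧ f.toFun t 0 ∈ S) →
    (∀ t ∈ Set.Icc (0:ℝ) 1, e₃.toFun t = ![e₃.toFun t 0, Complex.exp (-(↑Real.pi * Complex.I / (2 * (N : ℂ)))) *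
        (Complex.I * (1 - (e₃.toFun t 0) ^ N)) ^ ((N : ℂ)⁻¹)] ∧ e₃.toFun t 0 ∈ S) →
    e₂.toFun 0 = γ.toFun 0 → e₂.toFun 1 = f.toFun 0 → f.toFun 1 = e₃.toFun 0 → e₃.toFun 1 = γ.toFun 1 →
    ∃ (k : ℕ) (ρ : Fin k → (PeriodSymbol →₀ ℂ)) (a : Fin k → ℂ),
      (∀ l, IsElementaryRelation (ρ l)) ∧ (∀ l, IsAlgebraic ℚ (a l)) ∧
      (Finsupp.single (⟨(⟨2, 1, ![X 0 ^ N + X 1 ^ N - 1]⟩ : CurveData), hZ, ω, hω, e₂⟩ : PeriodSymbol) (1 : ℂ) +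
          Finsupp.single (⟨(⟨2, 1, ![X 0 ^ N + X 1 ^ N - 1]⟩ : CurveData), hZ, ω, hω, f⟩ : PeriodSymbol) (1 : ℂ) +
          Finsupp.single (⟨(⟨2, 1, ![X 0 ^ N + X 1 ^ N - 1]⟩ : CurveData), hZ, ω, hω, e₃⟩ : PeriodSymbol) (1 : ℂ) -
          Finsupp.single (⟨(⟨2, 1, ![X 0 ^ N + X 1 ^ N - 1]⟩ : CurveData), hZ, ω, hω, γ⟩ : PeriodSymbol) (1 : ℂ)) =
        ∑ l, a l • ρ l :=
  -- LANDED: Theorems/FermatIsogenyBetaLinearSector*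
  Summit.KontsevichZagierPeriods.FermatIsogeny.BetaLinearSector.stub_sectorLoopZ

/-- SECTOR STUB H2 (the loop in the chart at infinity is null-homotopic ⇒ its symbol is `∼ 0`). Same topology as
`stub_sectorLoopZ` for three paths `γ₂, d₃, fI` on the chart over a star-shaped `S` forming the loop
`γ₂(1) = d₃(0) →d₃→ d₃(1) = fI(1) →fI⁻→ fI(0) = γ₂(0) →γ₂→ γ₂(1)`: then `(d₃) − (fI) + (γ₂) ∼ 0`.
[cite: HuberWustholz2022, §3.3.1 (pp. 42–44)] -/
theorem stub_sectorLoopInfinity : ∀ (N : ℕ), 1 ≤ N → ∀ (S : Set ℂ), StarConvex ℝ (0 : ℂ) S →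
    ContinuousOn (fun z : ℂ => Complex.exp (-(↑Real.pi * Complex.I / (2 * (N : ℂ)))) * (Complex.I * (1 - z ^ N)) ^ ((N : ℂ)⁻¹)) S →
    (∀ z : ℂ, (![z, Complex.exp (-(↑Real.pi * Complex.I / (2 * (N : ℂ)))) * (Complex.I * (1 - z ^ N)) ^ ((N : ℂ)⁻¹)] :
        Fin 2 → ℂ) ∈ (⟨2, 1, ![X 0 ^ N + X 1 ^ N - 1]⟩ : CurveData).points) →
    ∀ (hZ : (⟨2, 1, ![X 0 ^ N + X 1 ^ N - 1]⟩ : CurveData).IsSmoothAffineCurve)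
      (ω : Fin 2 → MvPolynomial (Fin 2) ℂ) (hω : ∀ i, HasAlgCoeffs (ω i))
      (γ₂ d₃ f' : CurvePath (⟨2, 1, ![X 0 ^ N + X 1 ^ N - 1]⟩ : CurveData)),
    (∀ t ∈ Set.Icc (0:ℝ) 1, γ₂.toFun t = ![γ₂.toFun t 0, Complex.exp (-(↑Real.pi * Complex.I / (2 * (N : ℂ)))) *
        (Complex.I * (1 - (γ₂.toFun t 0) ^ N)) ^ ((N : ℂ)⁻¹)] ∧ γ₂.toFun t 0 ∈ S) →
    (∀ t ∈ Set.Icc (0:ℝ) 1, d₃.toFun t = ![d₃.toFun t 0, Complex.exp (-(↑Real.pi * Complex.I / (2 * (N : ℂ)))) *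
        (Complex.I * (1 - (d₃.toFun t 0) ^ N)) ^ ((N : ℂ)⁻¹)] ∧ d₃.toFun t 0 ∈ S) →
    (∀ t ∈ Set.Icc (0:ℝ) 1, f'.toFun t = ![f'.toFun t 0, Complex.exp (-(↑Real.pi * Complex.I / (2 * (N : ℂ)))) *
        (Complex.I * (1 - (f'.toFun t 0) ^ N)) ^ ((N : ℂ)⁻¹)] ∧ f'.toFun t 0 ∈ S) →
    d₃.toFun 0 = γ₂.toFun 1 → d₃.toFun 1 = f'.toFun 1 → f'.toFun 0 = γ₂.toFun 0 →
    ∃ (k : ℕ) (ρ : Fin k → (PeriodSymbol →₀ ℂ)) (a : Fin k → ℂ),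
      (∀ l, IsElementaryRelation (ρ l)) ∧ (∀ l, IsAlgebraic ℚ (a l)) ∧
      (Finsupp.single (⟨(⟨2, 1, ![X 0 ^ N + X 1 ^ N - 1]⟩ : CurveData), hZ, ω, hω, d₃⟩ : PeriodSymbol) (1 : ℂ) -
          Finsupp.single (⟨(⟨2, 1, ![X 0 ^ N + X 1 ^ N - 1]⟩ : CurveData), hZ, ω, hω, f'⟩ : PeriodSymbol) (1 : ℂ) +
          Finsupp.single (⟨(⟨2, 1, ![X 0 ^ N + X 1 ^ N - 1]⟩ : CurveData), hZ, ω, hω, γ₂⟩ : PeriodSymbol) (1 : ℂ)) =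
        ∑ l, a l • ρ l :=
  -- LANDED: Theorems/FermatIsogenyBetaLinearSector*
  Summit.KontsevichZagierPeriods.FermatIsogeny.BetaLinearSector.stub_sectorLoopInfinity

/-- SECTOR STUB T1 (transport along `g₂(x,y) = (1/x, εy/x)`, "invert `x`"). For positive `r, s, t` with `r + s + t = N` and any
`C¹` path `δ` on `F_N` avoiding `x = 0` on `[0,1]`, with `δ′ = g₂ ∘ δ`: `(F_N, ω_{r,s}, δ) − ε̄^s (F_N, ω_{t,s}, δ′) ∼ 0`. Proof: on
the auxiliary smooth affine curve `Z″ = {x^N + y^N = 1, xu = 1} ⊂ ℂ³ with the polynomial maps `p = (x, y)`, `q = (u, εyu)` to `F_N`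
one has `p^*ω_{r,s} − ε̄^s q^*ω_{t,s} = (1/N)·u^{N−r} y^s·d(x^N + y^N) mod (xu − 1)` — a form vanishing on `Z″` (R2): at a point of
`Z″` and a tangent vector `v`, `Σᵢ (p^*ω_{r,s} − ε̄^s q^*ω_{t,s})ᵢ vᵢ = x^{r−N} y^s (x^{N−1} v_x + y^{N−1} v_y) = 0`; lift `δ` to
`δ″ = (δ_x, δ_y, 1/δ_x)` and use (R4) twice, (R1). [cite: HuberWustholz2022, §13.1 (B) (p. 120)] [cite: Gross1978, §1] -/
theorem stub_transportInvX : ∀ (N r s t : ℕ), 1 ≤ r → 1 ≤ s → 1 ≤ t → r + s + t = N →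
    ∀ (hZ : (⟨2, 1, ![X 0 ^ N + X 1 ^ N - 1]⟩ : CurveData).IsSmoothAffineCurve)
      (hω : ∀ i, HasAlgCoeffs ((![X 0 ^ (r - 1) * X 1 ^ s, -(X 0 ^ r * X 1 ^ (s - 1))] :
        Fin 2 → MvPolynomial (Fin 2) ℂ) i))
      (hω' : ∀ i, HasAlgCoeffs ((![X 0 ^ (t - 1) * X 1 ^ s, -(X 0 ^ t * X 1 ^ (s - 1))] :
        Fin 2 → MvPolynomial (Fin 2) ℂ) i))
      (δ δ' : CurvePath (⟨2, 1, ![X 0 ^ N + X 1 ^ N - 1]⟩ : CurveData)),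
    (∀ t ∈ Set.Icc (0:ℝ) 1, δ.toFun t 0 ≠ 0) →
    (∀ t ∈ Set.Icc (0:ℝ) 1, δ'.toFun t =
      ![(δ.toFun t 0)⁻¹, Complex.exp (↑Real.pi * Complex.I / (N : ℂ)) * δ.toFun t 1 / δ.toFun t 0]) →
    ∃ (k : ℕ) (ρ : Fin k → (PeriodSymbol →₀ ℂ)) (a : Fin k → ℂ),
      (∀ l, IsElementaryRelation (ρ l)) ∧ (∀ l, IsAlgebraic ℚ (a l)) ∧
      (Finsupp.single (⟨(⟨2, 1, ![X 0 ^ N + X 1 ^ N - 1]⟩ : CurveData), hZ,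
            (![X 0 ^ (r - 1) * X 1 ^ s, -(X 0 ^ r * X 1 ^ (s - 1))] : Fin 2 → MvPolynomial (Fin 2) ℂ), hω, δ⟩ :
            PeriodSymbol) (1 : ℂ) -
          (Complex.exp (-(↑Real.pi * Complex.I / (N : ℂ)))) ^ s •
            Finsupp.single (⟨(⟨2, 1, ![X 0 ^ N + X 1 ^ N - 1]⟩ : CurveData), hZ,
              (![X 0 ^ (t - 1) * X 1 ^ s, -(X 0 ^ t * X 1 ^ (s - 1))] :
                Fin 2 → MvPolynomial (Fin 2) ℂ), hω', δ'⟩ : PeriodSymbol) (1 : ℂ)) =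
        ∑ l, a l • ρ l :=
  -- LANDED: Theorems/FermatIsogenyBetaLinearSector*
  Summit.KontsevichZagierPeriods.FermatIsogeny.BetaLinearSector.stub_transportInvX

/-- SECTOR STUB T2 (transport along `g₃(x,y) = (ε̄x/y, 1/y)`, "invert `y`"). For positive `r, s, t` with `r + s + t = N` and any
`C¹` path `δ` on `F_N` avoiding `y = 0` on `[0,1]`, with `δ′ = g₃ ∘ δ`: `(F_N, ω_{r,s}, δ) − ε^r (F_N, ω_{r,t}, δ′) ∼ 0` (auxiliary
curve `{x^N + y^N = 1, yw = 1}`, maps `p = (x,y)`, `q = (ε̄xw, w)`; `p^*ω_{r,s} − ε^r q^*ω_{r,t}` vanishes on it).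
[cite: HuberWustholz2022, §13.1 (B) (p. 120)] [cite: Gross1978, §1] -/
theorem stub_transportInvY : ∀ (N r s t : ℕ), 1 ≤ r → 1 ≤ s → 1 ≤ t → r + s + t = N →
    ∀ (hZ : (⟨2, 1, ![X 0 ^ N + X 1 ^ N - 1]⟩ : CurveData).IsSmoothAffineCurve)
      (hω : ∀ i, HasAlgCoeffs ((![X 0 ^ (r - 1) * X 1 ^ s, -(X 0 ^ r * X 1 ^ (s - 1))] :
        Fin 2 → MvPolynomial (Fin 2) ℂ) i))
      (hω' : ∀ i, HasAlgCoeffs ((![X 0 ^ (r - 1) * X 1 ^ t, -(X 0 ^ r * X 1 ^ (t - 1))] :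
        Fin 2 → MvPolynomial (Fin 2) ℂ) i))
      (δ δ' : CurvePath (⟨2, 1, ![X 0 ^ N + X 1 ^ N - 1]⟩ : CurveData)),
    (∀ t ∈ Set.Icc (0:ℝ) 1, δ.toFun t 1 ≠ 0) →
    (∀ t ∈ Set.Icc (0:ℝ) 1, δ'.toFun t =
      ![Complex.exp (-(↑Real.pi * Complex.I / (N : ℂ))) * δ.toFun t 0 / δ.toFun t 1, (δ.toFun t 1)⁻¹]) →
    ∃ (k : ℕ) (ρ : Fin k → (PeriodSymbol →₀ ℂ)) (a : Fin k → ℂ),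
      (∀ l, IsElementaryRelation (ρ l)) ∧ (∀ l, IsAlgebraic ℚ (a l)) ∧
      (Finsupp.single (⟨(⟨2, 1, ![X 0 ^ N + X 1 ^ N - 1]⟩ : CurveData), hZ,
            (![X 0 ^ (r - 1) * X 1 ^ s, -(X 0 ^ r * X 1 ^ (s - 1))] : Fin 2 → MvPolynomial (Fin 2) ℂ), hω, δ⟩ :
            PeriodSymbol) (1 : ℂ) -
          (Complex.exp (↑Real.pi * Complex.I / (N : ℂ))) ^ r •
            Finsupp.single (⟨(⟨2, 1, ![X 0 ^ N + X 1 ^ N - 1]⟩ : CurveData), hZ,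
              (![X 0 ^ (r - 1) * X 1 ^ t, -(X 0 ^ r * X 1 ^ (t - 1))] :
                Fin 2 → MvPolynomial (Fin 2) ℂ), hω', δ'⟩ : PeriodSymbol) (1 : ℂ)) =
        ∑ l, a l • ρ l :=
  -- LANDED: Theorems/FermatIsogenyBetaLinearSector*
  Summit.KontsevichZagierPeriods.FermatIsogeny.BetaLinearSector.stub_transportInvY

/-- SECTOR STUB KZ (transfer: a two-term arc relation ⇒ the rung). If for positive `r, s, t` with `r + s + t = N` and a real
algebraic `κ` the two-term symbol relation `(F_N, ω_{r,s}, γ_N) − κ (F_N, ω_{t,s}, γ_N) ∼ 0` holds (elementary decomposition),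
then Conjecture 1 holds for the pair of cells `[x^{r/N−1}(1−x)^{s/N−1}]`, `[c·x^{t/N−1}(1−x)^{s/N−1}]` on `(0,1)` with equal
values: `SectorGlue.realOnePeriodRelations_of_sector` with the two-symbol sector `{(F_N, ω_{r,s}, γ_N), (F_N, ω_{t,s}, γ_N)}`
(its Huber–Wüstholz hypothesis follows from the relation and `period ≠ 0`: a vanishing algebraic combination of the two symbols
is a multiple of the relation), cells ↔ symbols by the landed `stub_fermatSymbolData/Integrand/Realise` + `stub_realises` at the
prescribed level `N` (pattern `stub_betaArcs`), and `M₁ ≤ relations` (landed Green lemma). The constant `c` is forced to be `κ`.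
[cite: HuberWustholz2022, Thm 13.3 (2)] [cite: KontsevichZagier2001, §1.2] -/
theorem stub_rungOfArcRelation : ∀ (N r s t : ℕ), 1 ≤ r → 1 ≤ s → 1 ≤ t → r + s + t = N → ∀ (κ : ℝ), IsAlgebraic ℚ κ →
    (∀ (hZ : (⟨2, 1, ![X 0 ^ N + X 1 ^ N - 1]⟩ : CurveData).IsSmoothAffineCurve)
      (hω : ∀ i, HasAlgCoeffs ((![X 0 ^ (r - 1) * X 1 ^ s, -(X 0 ^ r * X 1 ^ (s - 1))] :
        Fin 2 → MvPolynomial (Fin 2) ℂ) i))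
      (hω' : ∀ i, HasAlgCoeffs ((![X 0 ^ (t - 1) * X 1 ^ s, -(X 0 ^ t * X 1 ^ (s - 1))] :
        Fin 2 → MvPolynomial (Fin 2) ℂ) i))
      (γ : CurvePath (⟨2, 1, ![X 0 ^ N + X 1 ^ N - 1]⟩ : CurveData)),
      (∀ u : ℝ, γ.toFun u = ![(((1 - u) * ((1 - u) ^ N + u ^ N) ^ (-(1:ℝ) / N) : ℝ) : ℂ),
        ((u * ((1 - u) ^ N + u ^ N) ^ (-(1:ℝ) / N) : ℝ) : ℂ)]) →
      ∃ (k : ℕ) (ρ : Fin k → (PeriodSymbol →₀ ℂ)) (a : Fin k → ℂ),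
        (∀ l, IsElementaryRelation (ρ l)) ∧ (∀ l, IsAlgebraic ℚ (a l)) ∧
        (Finsupp.single (⟨(⟨2, 1, ![X 0 ^ N + X 1 ^ N - 1]⟩ : CurveData), hZ,
              (![X 0 ^ (r - 1) * X 1 ^ s, -(X 0 ^ r * X 1 ^ (s - 1))] : Fin 2 → MvPolynomial (Fin 2) ℂ), hω, γ⟩ :
              PeriodSymbol) (1 : ℂ) -
            (κ : ℂ) • Finsupp.single (⟨(⟨2, 1, ![X 0 ^ N + X 1 ^ N - 1]⟩ : CurveData), hZ,
              (![X 0 ^ (t - 1) * X 1 ^ s, -(X 0 ^ t * X 1 ^ (s - 1))] : Fin 2 → MvPolynomial (Fin 2) ℂ), hω', γ⟩ :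
              PeriodSymbol) (1 : ℂ)) =
          ∑ l, a l • ρ l) →
    ∀ (c : ℝ) (ρ ρ' : KZ.IntegralRep 1),
      ρ.domain = {x | x 0 ∈ Set.Ioo (0:ℝ) 1} →
      Set.EqOn ρ.integrand (fun x => (x 0) ^ ((r:ℝ) / N - 1) * (1 - x 0) ^ ((s:ℝ) / N - 1)) ρ.domain →
      ρ'.domain = {x | x 0 ∈ Set.Ioo (0:ℝ) 1} →
      Set.EqOn ρ'.integrand (fun x => c * (x 0) ^ ((t:ℝ) / N - 1) * (1 - x 0) ^ ((s:ℝ) / N - 1)) ρ'.domain →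
      ρ.value = ρ'.value → KZ.Equivalent ρ ρ' :=
  -- LANDED: Theorems/FermatIsogenyBetaLinearSector*
  Summit.KontsevichZagierPeriods.FermatIsogeny.BetaLinearSector.stub_rungOfArcRelation


/-! ## Stubs held by the lead (assembly) -/

/-- SECTOR STUB SW (the swap `(x,y) ↦ (y,x)`): for any path `δ` on `F_N` and `δ′ = swap ∘ δ`,
`(F_N, ω_{i,j}, δ) + (F_N, ω_{j,i}, δ′) ∼ 0` ((R4) along the polynomial automorphism `swap`, `swap^*ω_{j,i} = −ω_{i,j}`, and (R1)).
[cite: HuberWustholz2022, §13.1 (B) (p. 120)] -/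
theorem stub_swapRel : ∀ (N i j : ℕ), 1 ≤ i → 1 ≤ j →
    ∀ (hZ : (⟨2, 1, ![X 0 ^ N + X 1 ^ N - 1]⟩ : CurveData).IsSmoothAffineCurve)
      (hω : ∀ l, HasAlgCoeffs ((![X 0 ^ (i - 1) * X 1 ^ j, -(X 0 ^ i * X 1 ^ (j - 1))] :
        Fin 2 → MvPolynomial (Fin 2) ℂ) l))
      (hω' : ∀ l, HasAlgCoeffs ((![X 0 ^ (j - 1) * X 1 ^ i, -(X 0 ^ j * X 1 ^ (i - 1))] :
        Fin 2 → MvPolynomial (Fin 2) ℂ) l))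
      (δ δ' : CurvePath (⟨2, 1, ![X 0 ^ N + X 1 ^ N - 1]⟩ : CurveData)),
    (∀ t ∈ Set.Icc (0:ℝ) 1, δ'.toFun t = ![δ.toFun t 1, δ.toFun t 0]) →
    ∃ (k : ℕ) (ρ : Fin k → (PeriodSymbol →₀ ℂ)) (a : Fin k → ℂ),
      (∀ l, IsElementaryRelation (ρ l)) ∧ (∀ l, IsAlgebraic ℚ (a l)) ∧
      (Finsupp.single (⟨(⟨2, 1, ![X 0 ^ N + X 1 ^ N - 1]⟩ : CurveData), hZ,
            (![X 0 ^ (i - 1) * X 1 ^ j, -(X 0 ^ i * X 1 ^ (j - 1))] : Fin 2 → MvPolynomial (Fin 2) ℂ), hω, δ⟩ :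
            PeriodSymbol) (1 : ℂ) +
          Finsupp.single (⟨(⟨2, 1, ![X 0 ^ N + X 1 ^ N - 1]⟩ : CurveData), hZ,
            (![X 0 ^ (j - 1) * X 1 ^ i, -(X 0 ^ j * X 1 ^ (i - 1))] : Fin 2 → MvPolynomial (Fin 2) ℂ), hω', δ'⟩ :
            PeriodSymbol) (1 : ℂ)) =
        ∑ l, a l • ρ l :=
  -- LANDED: Theorems/FermatIsogenyBetaLinearSector*
  Summit.KontsevichZagierPeriods.FermatIsogeny.BetaLinearSector.stub_swapRel

/-- SECTOR STUB U (the UPPER SECTOR RELATION, assembled by the lead from B1, P, H1, H2, T1, T2, SW): for positive `r, s, t`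
with `r + s + t = N`: `(F_N, ω_{r,s}, γ_N) − ε̄^s (F_N, ω_{t,s}, γ_N) − ε^r (F_N, ω_{r,t}, γ_N) ∼ 0` — Cauchy's theorem on the
sector `{0 ≤ arg x ≤ π/N}` of one sheet of `F_N(ℂ)`; on periods: `B(a,b) = e^{−iπb} B(1−a−b, b) + e^{iπa} B(a, 1−a−b)`,
`a = r/N`, `b = s/N`. [cite: Gross1978, §1 (Rohrlich's appendix)] -/
theorem stub_upperSector : ∀ (N r s t : ℕ), 3 ≤ N → 1 ≤ r → 1 ≤ s → 1 ≤ t → r + s + t = N →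
    ∀ (hZ : (⟨2, 1, ![X 0 ^ N + X 1 ^ N - 1]⟩ : CurveData).IsSmoothAffineCurve)
      (hω₁ : ∀ l, HasAlgCoeffs ((![X 0 ^ (r - 1) * X 1 ^ s, -(X 0 ^ r * X 1 ^ (s - 1))] :
        Fin 2 → MvPolynomial (Fin 2) ℂ) l))
      (hω₂ : ∀ l, HasAlgCoeffs ((![X 0 ^ (t - 1) * X 1 ^ s, -(X 0 ^ t * X 1 ^ (s - 1))] :
        Fin 2 → MvPolynomial (Fin 2) ℂ) l))
      (hω₃ : ∀ l, HasAlgCoeffs ((![X 0 ^ (r - 1) * X 1 ^ t, -(X 0 ^ r * X 1 ^ (t - 1))] :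
        Fin 2 → MvPolynomial (Fin 2) ℂ) l))
      (γ : CurvePath (⟨2, 1, ![X 0 ^ N + X 1 ^ N - 1]⟩ : CurveData)),
    (∀ u : ℝ, γ.toFun u = ![(((1 - u) * ((1 - u) ^ N + u ^ N) ^ (-(1:ℝ) / N) : ℝ) : ℂ),
      ((u * ((1 - u) ^ N + u ^ N) ^ (-(1:ℝ) / N) : ℝ) : ℂ)]) →
    ∃ (k : ℕ) (ρ : Fin k → (PeriodSymbol →₀ ℂ)) (a : Fin k → ℂ),
      (∀ l, IsElementaryRelation (ρ l)) ∧ (∀ l, IsAlgebraic ℚ (a l)) ∧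
      (Finsupp.single (⟨(⟨2, 1, ![X 0 ^ N + X 1 ^ N - 1]⟩ : CurveData), hZ,
            (![X 0 ^ (r - 1) * X 1 ^ s, -(X 0 ^ r * X 1 ^ (s - 1))] : Fin 2 → MvPolynomial (Fin 2) ℂ), hω₁, γ⟩ :
            PeriodSymbol) (1 : ℂ) -
          (Complex.exp (-(↑Real.pi * Complex.I / (N : ℂ)))) ^ s •
            Finsupp.single (⟨(⟨2, 1, ![X 0 ^ N + X 1 ^ N - 1]⟩ : CurveData), hZ,
              (![X 0 ^ (t - 1) * X 1 ^ s, -(X 0 ^ t * X 1 ^ (s - 1))] : Fin 2 → MvPolynomial (Fin 2) ℂ), hω₂, γ⟩ :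
              PeriodSymbol) (1 : ℂ) -
          (Complex.exp (↑Real.pi * Complex.I / (N : ℂ))) ^ r •
            Finsupp.single (⟨(⟨2, 1, ![X 0 ^ N + X 1 ^ N - 1]⟩ : CurveData), hZ,
              (![X 0 ^ (r - 1) * X 1 ^ t, -(X 0 ^ r * X 1 ^ (t - 1))] : Fin 2 → MvPolynomial (Fin 2) ℂ), hω₃, γ⟩ :
              PeriodSymbol) (1 : ℂ)) =
        ∑ l, a l • ρ l :=
  -- LANDED: Theorems/FermatIsogenyBetaLinearSector*
  Summit.KontsevichZagierPeriods.FermatIsogeny.BetaLinearSector.stub_upperSector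

/-- SECTOR STUB TT (the TWO-TERM RELATION, lead): for positive `r, s, t` with `r + s + t = N`,
`(F_N, ω_{r,s}, γ_N) − κ (F_N, ω_{t,s}, γ_N) ∼ 0` with `κ = sin(π(r+s)/N) / sin(πr/N)` — eliminate `(F_N, ω_{r,t}, γ_N)` between
the upper sector relations for `(r,s,t)` and `(t,s,r)` using the swap `(ω_{t,r}, γ_N) ∼ (ω_{r,t}, γ_N)`; on periods:
`B(a,b) sin πa = B(1−a−b, b) sin π(a+b)`. [cite: Gross1978, §1 (Rohrlich's appendix)] -/
theorem stub_twoTermRelation : ∀ (N r s t : ℕ), 3 ≤ N → 1 ≤ r → 1 ≤ s → 1 ≤ t → r + s + t = N →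
    ∀ (hZ : (⟨2, 1, ![X 0 ^ N + X 1 ^ N - 1]⟩ : CurveData).IsSmoothAffineCurve)
      (hω₁ : ∀ l, HasAlgCoeffs ((![X 0 ^ (r - 1) * X 1 ^ s, -(X 0 ^ r * X 1 ^ (s - 1))] :
        Fin 2 → MvPolynomial (Fin 2) ℂ) l))
      (hω₂ : ∀ l, HasAlgCoeffs ((![X 0 ^ (t - 1) * X 1 ^ s, -(X 0 ^ t * X 1 ^ (s - 1))] :
        Fin 2 → MvPolynomial (Fin 2) ℂ) l))
      (γ : CurvePath (⟨2, 1, ![X 0 ^ N + X 1 ^ N - 1]⟩ : CurveData)),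
    (∀ u : ℝ, γ.toFun u = ![(((1 - u) * ((1 - u) ^ N + u ^ N) ^ (-(1:ℝ) / N) : ℝ) : ℂ),
      ((u * ((1 - u) ^ N + u ^ N) ^ (-(1:ℝ) / N) : ℝ) : ℂ)]) →
    ∃ (k : ℕ) (ρ : Fin k → (PeriodSymbol →₀ ℂ)) (a : Fin k → ℂ),
      (∀ l, IsElementaryRelation (ρ l)) ∧ (∀ l, IsAlgebraic ℚ (a l)) ∧
      (Finsupp.single (⟨(⟨2, 1, ![X 0 ^ N + X 1 ^ N - 1]⟩ : CurveData), hZ,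
            (![X 0 ^ (r - 1) * X 1 ^ s, -(X 0 ^ r * X 1 ^ (s - 1))] : Fin 2 → MvPolynomial (Fin 2) ℂ), hω₁, γ⟩ :
            PeriodSymbol) (1 : ℂ) -
          ((Real.sin (Real.pi * (r + s) / N) / Real.sin (Real.pi * r / N) : ℝ) : ℂ) •
            Finsupp.single (⟨(⟨2, 1, ![X 0 ^ N + X 1 ^ N - 1]⟩ : CurveData), hZ,
              (![X 0 ^ (t - 1) * X 1 ^ s, -(X 0 ^ t * X 1 ^ (s - 1))] : Fin 2 → MvPolynomial (Fin 2) ℂ), hω₂, γ⟩ :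
              PeriodSymbol) (1 : ℂ)) =
        ∑ l, a l • ρ l :=
  -- LANDED: Theorems/FermatIsogenyBetaLinearSector*
  Summit.KontsevichZagierPeriods.FermatIsogeny.BetaLinearSector.stub_twoTermRelation

/-- `sin(πm/N)` is an algebraic number (`= (ε^m − ε̄^m)/(2i)`, `ε = e^{iπ/N}`). [folklore] -/
theorem fermatReflection_isAlgebraic_sin {N : ℕ} (hN : N ≠ 0) (m : ℕ) :
    IsAlgebraic ℚ (Real.sin (Real.pi * m / N)) := by
  have hI : IsAlgebraic ℚ Complex.I := by
    refine ⟨Polynomial.X ^ 2 + Polynomial.C 1, (Polynomial.monic_X_pow_add_C (1:ℚ) two_ne_zero).ne_zero, ?_⟩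
    simp
  have h2 : IsAlgebraic ℚ (2 : ℂ) := by simpa using isAlgebraic_algebraMap (R := ℚ) (A := ℂ) (2 : ℚ)
  have hC : IsAlgebraic ℚ ((Real.sin (Real.pi * m / N) : ℝ) : ℂ) := by
    have h : ((Real.sin (Real.pi * m / N) : ℝ) : ℂ) =
        (Complex.exp (↑Real.pi * Complex.I / (N : ℂ)) ^ m - Complex.exp (-(↑Real.pi * Complex.I / (N : ℂ))) ^ m) *
          (2 * Complex.I)⁻¹ := by
      rw [Summit.KontsevichZagierPeriods.FermatIsogeny.BetaLinearSector.twoTerm_pow_sub_pow, Complex.ofReal_sin]; push_cast; field_simp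
    rw [h]
    exact (((Summit.KontsevichZagierPeriods.FermatIsogeny.BetaLinearSector.sectorPaths_algebraic_eps hN).pow m).sub ((Summit.KontsevichZagierPeriods.FermatIsogeny.BetaLinearSector.sectorPaths_algebraic_epsBar hN).pow m)).mul
      (h2.mul hI).inv
  exact (isAlgebraic_algebraMap_iff (R := ℚ) (A := ℂ) Complex.ofReal_injective).mp hC

/-- SECTOR STUB R (the RUNG, lead): **the Fermat reflection class of the crux at ALL levels** — for positive rationals with
`a + b + a′ = 1`, `b′ = b` (so `B(a,b) = [sin π(a+b)/sin πa]·B(a′,b′)`, the S₃-symmetry of `F_N` exchanging the cusps `x = 0` and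
`z = 0`), the two pinned representations with equal values are KZ-equivalent. No transcendence input (`c` is forced).
From `stub_twoTermRelation` and `stub_rungOfArcRelation` at the common level `N = den(a)·den(b)`.
[cite: KontsevichZagier2001, §1.2] [cite: Gross1978, §1 (Rohrlich's appendix)] -/
theorem stub_fermatReflectionRung : ∀ (a b a' b' : ℚ) (c : ℝ), 0 < a → 0 < b → 0 < a' → 0 < b' → IsAlgebraic ℚ c →
    a + b + a' = 1 → b' = b →
    ∀ (r r' : KZ.IntegralRep 1),
      r.domain = {x | x 0 ∈ Set.Ioo (0:ℝ) 1} →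
      Set.EqOn r.integrand (fun x => (x 0) ^ ((a:ℝ) - 1) * (1 - x 0) ^ ((b:ℝ) - 1)) r.domain →
      r'.domain = {x | x 0 ∈ Set.Ioo (0:ℝ) 1} →
      Set.EqOn r'.integrand (fun x => c * (x 0) ^ ((a':ℝ) - 1) * (1 - x 0) ^ ((b':ℝ) - 1)) r'.domain →
      r.value = r'.value → KZ.Equivalent r r' := by
  -- LANDED as Summit.KontsevichZagierPeriods.FermatIsogeny.BetaLinearSector.stub_fermatReflectionRung (p171372); the proof is kept
  -- inline so that this workfile does not import the freshest module.
  intro a b a' b' c ha hb ha' _ _ hsum hb' ρ ρ' hd hi hd' hi' hv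
  have hb'R : (b' : ℝ) = b := by exact_mod_cast hb'
  -- level `N` and numerators: `a = r/N`, `b = s/N`
  obtain ⟨N, r, s, hN, hr, hs, haN, hbN⟩ : ∃ N r s : ℕ, 1 ≤ N ∧ 1 ≤ r ∧ 1 ≤ s ∧
      (a : ℝ) = (r : ℝ) / N ∧ (b : ℝ) = (s : ℝ) / N := by
    refine ⟨a.den * b.den, a.num.toNat * b.den, b.num.toNat * a.den, Nat.one_le_iff_ne_zero.2
      (Nat.mul_ne_zero a.den_nz b.den_nz), ?_, ?_, ?_, ?_⟩
    · exact Nat.one_le_iff_ne_zero.2 (Nat.mul_ne_zero (by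
        have := Rat.num_pos.2 ha; omega) b.den_nz)
    · exact Nat.one_le_iff_ne_zero.2 (Nat.mul_ne_zero (by
        have := Rat.num_pos.2 hb; omega) a.den_nz)
    · have hnum : ((a.num.toNat : ℕ) : ℝ) = (a.num : ℝ) := by
        have h0 : 0 ≤ a.num := (Rat.num_pos.2 ha).le
        exact_mod_cast Int.toNat_of_nonneg h0
      have hq : (a : ℝ) = (a.num : ℝ) / (a.den : ℝ) := by exact_mod_cast (Rat.num_div_den a).symm
      rw [hq]
      push_cast
      rw [hnum]
      have hb0 : (b.den : ℝ) ≠ 0 := by exact_mod_cast b.den_nz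
      have ha0 : (a.den : ℝ) ≠ 0 := by exact_mod_cast a.den_nz
      field_simp
    · have hnum : ((b.num.toNat : ℕ) : ℝ) = (b.num : ℝ) := by
        have h0 : 0 ≤ b.num := (Rat.num_pos.2 hb).le
        exact_mod_cast Int.toNat_of_nonneg h0
      have hq : (b : ℝ) = (b.num : ℝ) / (b.den : ℝ) := by exact_mod_cast (Rat.num_div_den b).symm
      rw [hq]
      push_cast
      rw [hnum]
      have hb0 : (b.den : ℝ) ≠ 0 := by exact_mod_cast b.den_nz
      have ha0 : (a.den : ℝ) ≠ 0 := by exact_mod_cast a.den_nz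
      field_simp
  -- the third numerator `t = N − r − s ≥ 1` (`a′ = 1 − a − b > 0`)
  have hNr : (0:ℝ) < N := by exact_mod_cast (show 0 < N by omega)
  have ha'R : (a' : ℝ) = 1 - (r : ℝ) / N - (s : ℝ) / N := by
    have h : (a' : ℚ) = 1 - a - b := by linarith
    rw [← haN, ← hbN]; exact_mod_cast h
  have hlt : r + s < N := by
    have h0 : (0:ℝ) < a' := by exact_mod_cast ha'
    rw [ha'R] at h0
    have : ((r:ℝ) + s) / N < 1 := by rw [add_div]; linarith
    rw [div_lt_one hNr] at this
    exact_mod_cast this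
  obtain ⟨t, ht, hsum'⟩ : ∃ t : ℕ, 1 ≤ t ∧ r + s + t = N := ⟨N - r - s, by omega, by omega⟩
  have htN : (a' : ℝ) = (t : ℝ) / N := by
    rw [ha'R]
    have : (t : ℝ) = N - r - s := by
      have h : ((r : ℝ) + s + t = N) := by exact_mod_cast hsum'
      linarith
    rw [this]
    field_simp
  have hN3 : 3 ≤ N := by omega
  have hN0 : N ≠ 0 := by omega
  -- the two-term relation at level `N` and the transfer
  have hκ : IsAlgebraic ℚ (Real.sin (Real.pi * (r + s) / N) / Real.sin (Real.pi * r / N)) := by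
    have h1 := fermatReflection_isAlgebraic_sin hN0 (r + s)
    have h2 := fermatReflection_isAlgebraic_sin hN0 r
    push_cast at h1
    exact h1.mul h2.inv
  refine stub_rungOfArcRelation N r s t hr hs ht hsum' _ hκ
    (fun hZ hω hω' γ hγ => stub_twoTermRelation N r s t hN3 hr hs ht hsum' hZ hω hω' γ hγ) c ρ ρ' hd ?_ hd' ?_ hv
  · intro x hx
    rw [hi hx, haN, hbN]
  · intro x hx
    rw [hi' hx, htN, hb'R, hbN]




/-! ## Reshape 3 (lead c4, cycle 2): the OBVIOUS KOBLITZ–ROHRLICH CLASS of a holomorphic triple, at all levels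

With the reflection rung two-sided (constants on both cells, `stub_pinnedReflect`, from `stub_fermatReflectionRung` by scaling
`KZ.IntegralRep.constMul`) and c3's translation–swap machinery (`P_of_class_left`, `P_swap_left`, `P_symm`, `P_diag`, landed), the
crux holds on the whole orbit of a holomorphic triple `(a₀, b₀, 1−a₀−b₀)` (`a₀ + b₀ < 1`) under `S₃ × ℤ²` (`stub_fermatS3Class`,
implication-shaped): every "obvious" coincidence of Koblitz–Rohrlich 1978 (p. 1184) among holomorphic differentials of `F_N`, every `N`. -/

/-- SECTOR STUB PR (two-sided reflection with constants, implication-shaped): the one-sided reflection rung (the statement of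
`stub_fermatReflectionRung`) implies its two-sided form — for positive rationals `a, b` with `a + b < 1` and real algebraic `c, c′`,
two representations pinned as `[c·x^{a−1}(1−x)^{b−1}]`, `[c′·x^{−a−b}(1−x)^{b−1}]` on `(0,1)` with equal values are KZ-equivalent
(`c = 0` degenerate: both integrands vanish; else scale the one-sided rung for the cells with constants `1`, `c′/c` by `c`:
`exists_pinned`, `equivalent_constMul_of_pinned`, `Equivalent.constMul`, `value_of_pinned`). [cite: KontsevichZagier2001, §1.2] -/
theorem stub_pinnedReflect :
    (∀ (a b a' b' : ℚ) (c : ℝ), 0 < a → 0 < b → 0 < a' → 0 < b' → IsAlgebraic ℚ c → a + b + a' = 1 → b' = b →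
      ∀ (r r' : KZ.IntegralRep 1),
        r.domain = {x | x 0 ∈ Set.Ioo (0:ℝ) 1} →
        Set.EqOn r.integrand (fun x => (x 0) ^ ((a:ℝ) - 1) * (1 - x 0) ^ ((b:ℝ) - 1)) r.domain →
        r'.domain = {x | x 0 ∈ Set.Ioo (0:ℝ) 1} →
        Set.EqOn r'.integrand (fun x => c * (x 0) ^ ((a':ℝ) - 1) * (1 - x 0) ^ ((b':ℝ) - 1)) r'.domain →
        r.value = r'.value → KZ.Equivalent r r') →
    ∀ (a b : ℚ), 0 < a → 0 < b → a + b < 1 → ∀ (c c' : ℝ) (r r' : KZ.IntegralRep 1),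
    IsAlgebraic ℚ c → IsAlgebraic ℚ c' →
    (r.domain = {x | x 0 ∈ Set.Ioo (0:ℝ) 1} ∧
      Set.EqOn r.integrand (fun x => c * (x 0) ^ ((a:ℝ) - 1) * (1 - x 0) ^ ((b:ℝ) - 1)) r.domain) →
    (r'.domain = {x | x 0 ∈ Set.Ioo (0:ℝ) 1} ∧
      Set.EqOn r'.integrand (fun x => c' * (x 0) ^ (((1 - a - b : ℚ) : ℝ) - 1) * (1 - x 0) ^ ((b:ℝ) - 1)) r'.domain) →
    r.value = r'.value → KZ.Equivalent r r' :=
  -- LANDED: Theorems/FermatIsogenyBetaLinearSector*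
  Summit.KontsevichZagierPeriods.FermatIsogeny.BetaLinearSector.stub_pinnedReflect

/-- SECTOR STUB S3 (the obvious class, implication-shaped): if the two-sided reflection holds for every holomorphic triple, then the
crux holds for every pair `(a, b)`, `(a′, b′)` congruent modulo `ℤ²` to two members of the `S₃`-orbit
`{(a₀,b₀), (b₀,a₀), (t₀,b₀), (b₀,t₀), (a₀,t₀), (t₀,a₀)}`, `t₀ = 1 − a₀ − b₀`, of a holomorphic triple (`a₀, b₀ > 0`, `a₀ + b₀ < 1`):
level reduction on both pairs (`P_of_class_left`, `P_symm`), uniqueness of the window representative, and the six cases by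
`P_diag`, `P_swap_left` and the reflection. [cite: KontsevichZagier2001, §1.2] -/
theorem stub_fermatS3Class :
    (∀ (a b : ℚ), 0 < a → 0 < b → a + b < 1 → ∀ (c c' : ℝ) (r r' : KZ.IntegralRep 1),
      IsAlgebraic ℚ c → IsAlgebraic ℚ c' →
      (r.domain = {x | x 0 ∈ Set.Ioo (0:ℝ) 1} ∧
        Set.EqOn r.integrand (fun x => c * (x 0) ^ ((a:ℝ) - 1) * (1 - x 0) ^ ((b:ℝ) - 1)) r.domain) →
      (r'.domain = {x | x 0 ∈ Set.Ioo (0:ℝ) 1} ∧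
        Set.EqOn r'.integrand (fun x => c' * (x 0) ^ (((1 - a - b : ℚ) : ℝ) - 1) * (1 - x 0) ^ ((b:ℝ) - 1)) r'.domain) →
      r.value = r'.value → KZ.Equivalent r r') →
    ∀ (a b a' b' : ℚ) (c : ℝ), 0 < a → 0 < b → 0 < a' → 0 < b' → IsAlgebraic ℚ c →
    (∃ (a₀ b₀ a₁ b₁ : ℚ) (i j i' j' : ℤ), 0 < a₀ ∧ 0 < b₀ ∧ a₀ + b₀ < 1 ∧
      a = a₀ + i ∧ b = b₀ + j ∧ a' = a₁ + i' ∧ b' = b₁ + j' ∧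
      ((a₁ = a₀ ∧ b₁ = b₀) ∨ (a₁ = b₀ ∧ b₁ = a₀) ∨ (a₁ = 1 - a₀ - b₀ ∧ b₁ = b₀) ∨ (a₁ = b₀ ∧ b₁ = 1 - a₀ - b₀) ∨
        (a₁ = a₀ ∧ b₁ = 1 - a₀ - b₀) ∨ (a₁ = 1 - a₀ - b₀ ∧ b₁ = a₀))) →
    ∀ (r r' : KZ.IntegralRep 1),
      r.domain = {x | x 0 ∈ Set.Ioo (0:ℝ) 1} →
      Set.EqOn r.integrand (fun x => (x 0) ^ ((a:ℝ) - 1) * (1 - x 0) ^ ((b:ℝ) - 1)) r.domain →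
      r'.domain = {x | x 0 ∈ Set.Ioo (0:ℝ) 1} →
      Set.EqOn r'.integrand (fun x => c * (x 0) ^ ((a':ℝ) - 1) * (1 - x 0) ^ ((b':ℝ) - 1)) r'.domain →
      r.value = r'.value → KZ.Equivalent r r' :=
  -- LANDED: Theorems/FermatIsogenyBetaLinearSector*
  Summit.KontsevichZagierPeriods.FermatIsogeny.BetaLinearSector.stub_fermatS3Class

/-- **THE OBVIOUS KOBLITZ–ROHRLICH CLASS AT ALL LEVELS** (composition of the two stubs above): the crux on the `S₃ × ℤ²`-orbit of
every holomorphic triple. [cite: KontsevichZagier2001, §1.2] -/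
theorem betaLinearSector_fermatS3Class : ∀ (a b a' b' : ℚ) (c : ℝ), 0 < a → 0 < b → 0 < a' → 0 < b' → IsAlgebraic ℚ c →
    (∃ (a₀ b₀ a₁ b₁ : ℚ) (i j i' j' : ℤ), 0 < a₀ ∧ 0 < b₀ ∧ a₀ + b₀ < 1 ∧
      a = a₀ + i ∧ b = b₀ + j ∧ a' = a₁ + i' ∧ b' = b₁ + j' ∧
      ((a₁ = a₀ ∧ b₁ = b₀) ∨ (a₁ = b₀ ∧ b₁ = a₀) ∨ (a₁ = 1 - a₀ - b₀ ∧ b₁ = b₀) ∨ (a₁ = b₀ ∧ b₁ = 1 - a₀ - b₀) ∨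
        (a₁ = a₀ ∧ b₁ = 1 - a₀ - b₀) ∨ (a₁ = 1 - a₀ - b₀ ∧ b₁ = a₀))) →
    ∀ (r r' : KZ.IntegralRep 1),
      r.domain = {x | x 0 ∈ Set.Ioo (0:ℝ) 1} →
      Set.EqOn r.integrand (fun x => (x 0) ^ ((a:ℝ) - 1) * (1 - x 0) ^ ((b:ℝ) - 1)) r.domain →
      r'.domain = {x | x 0 ∈ Set.Ioo (0:ℝ) 1} →
      Set.EqOn r'.integrand (fun x => c * (x 0) ^ ((a':ℝ) - 1) * (1 - x 0) ^ ((b':ℝ) - 1)) r'.domain →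
      r.value = r'.value → KZ.Equivalent r r' :=
  stub_fermatS3Class (stub_pinnedReflect stub_fermatReflectionRung)

end Summit.KontsevichZagierPeriods.KontsevichZagierPeriods.Cruxes.BetaLinearSector.FermatSectorTransport

end
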